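import Summits.BirchSwinnertonDyer.BirchSwinnertonDyer.Theorems.ErratumRoadFiveBstwDoorValuationIneqR
import Summits.BirchSwinnertonDyer.BirchSwinnertonDyer.Theorems.ErratumRoadFiveBdvCalibrationSplitNF
import HarnessLib

/-!
# The EXCEPTIONAL (split multiplicative, `a_p = +1`) twin of the BDV-calibration road ON THE AMENDED EXPONENT R —
# a typed door for the aside atom `ErratumRoadFive.KatoValuationIneqSplitAtFive` (stmt-BirchSwinnertonDyer-33168, 370 pairs)
# (crux of record `ErratumRoadFive.EulerHalfNotRamNoInertSetAtFive`, stmt-BirchSwinnertonDyer-19715; WORKFILE, unregistered)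

Seat bsd-idea-9 g52 (planner; lens = complete, D-0154 §B; W-71/W-79: `ledger crux write` only — no route birth, no
`skeleton check`, kit 0), 2026-08-31.  rev 1.2 (DOCSTRING-ONLY over rev 1.0 = crux-write 430fe0d7f330, sha16 f77f4f1d1c1e9b0e:
rev 1.1 = 80d73ca33b13 paid critic V386 P1 by option (c), the BOOKING CLAIM below, with (a)/(b) recorded as its discharge routes, and
note N1 (preprint loci); rev 1.2 sharpens the claim's list of LIVE constants (`c_1` multiplies `L(f, k_o/2)^{alg} = 0` and drops out);
N2/N3 are for the pen.  Every Lean body is rev 1.0's, token for token.)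

WHAT THIS FILE IS.  The line of record of crux 19715 (`Lines/kato_Fframe_r5.lean`, r5.7) rests on S0′ and the two research
atoms `stub_valuationIneqSplit` = item 33168 `KatoValuationIneqSplitAtFive` (370 pairs) and `stub_valuationIneqNonsplit` =
item 33169 `KatoValuationIneqNonsplitAtFive` (34 pairs), BY NAME.  The NON-split atom has a typed and now BUILT door: the
LEAD's d2R P1 modules `ErratumRoadFiveBdvCalibrationSplitRDefs` ∕ `…SplitR` ∕ `…BstwDoorBdpFrameValue` ∕ `…BstwDoorCrossingR` ∕
`…BstwDoorValuationIneqR` (p806950 · p807901 · p807175 · p808053 · p808156) reach `KatoValuationIneqNonsplitAtFive` BY NAME from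
S0′ ∧ S1R (`BdvChainExplicitNonsplitR`) ∧ S2R (`EisensteinPeriodRatioValuationR`, or its pieces S2a ∧ S2c ∧ S2bR), and — d2R P2,
p809716 · p809731 · p810158, the NF road the 33169 registry r3 (`Lines/bstw_door.lean`, sha16 24679077dd891ca9, pen g52 04:25:09Z) takes —
from S0′ ∧ `BdvCalibrationPiecesNFR` (= P-free SUPPLY ∧ ∃P{S1-NF-on-R ∧ REALISABILITY ∧ BSTW-PR-NF}).  The SPLIT atom
had nothing: no workfile, no crux directory, no typed mechanism (door rev 3.9 §3b typed its compositions on the PRE-R exponent,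
inside an unbuilt Cruxes sketch, and recorded «NO mechanism in hand»).  This file gives it the SAME door, on R, importing the five
built modules BY NAME, and types the one printed mechanism for the split sign that needs no auxiliary inert set:

* §0 VOCABULARY.  `bdvExplicitExponentExcR` — the explicit crossing exponent at an EXCEPTIONAL prime (leading integer `1`, then
  `+ ord_p c − ord_p s − ord_p k − (ord_p r_f − ord_p m_f) − v_p φ(N) − v`), with two certificates: at a NON-split multiplicative
  `p ≥ 5` it EQUALS the registered `bdvExplicitExponentR p a_p …` (`a_p = −1`, Kraus–Oesterlé) — ONE exponent for both
  multiplicative signs, the kernel form of door rev 3.9's «same exponent, forced not chosen» (A♯ `bdpFrameValue` and B are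
  sign-free and `ord_p(1 − a_p p⁻¹) = −1` for `a_p = ±1`) — while at a SPLIT `p` the registered formula is OFF BY ONE (its
  good-reduction `a_p`-term `1 − v_p(p + 1 − a_p)` reads `1 − v_p(p) = 0` at `a_p = +1`): `bdvExplicitExponentR` must NOT be
  instantiated at a split prime, hence a separate constant.  `ExceptionalRankOneAt W p` (analytic rank one, `E[p]` irreducible,
  `p` split multiplicative = BDV22's «f is p-exceptional», §5 p. 45 L47–49).  `BdvChainCurveConjunctExcR V` — BDV22 §5 (Thm. 5.1
  p. 46 L11–33 ∧ Thm. 5.2 p. 47 L13–33 ∧ Lemma 4.6, concluded in §5.3 p. 48 L38–40) VALUED up to the g-only constant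
  `L(g)/log_p(u_p)`, which is THE SAME constant as in §4 (Thm. 5.1: «let L(g) in L^* be as in Section 4.6», p. 46 L11–12; census
  `Lines/bdv22_sec4_constant_ledger.md` rev 1.3 F4′): the exceptional CURVE CONJUNCT at a shift `V : ℕ → ℤ → ℤ`, i.e. the NF-port's
  `BdvChainCurveConjunctR V` (p809716) with `NonExceptionalRankOneAt ↦ ExceptionalRankOneAt` and `bdvExplicitExponentR p a_p … ↦
  bdvExplicitExponentExcR p …`.  S1⁺ = `BdvChainExplicitExcR := ∃ V, BdvChainCurveConjunctR V ∧ BdvChainCurveConjunctExcR V` — ONE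
  shift for §4 and §5.  `AFlatFamExcStatementR` — door rev 3.9's A♭-fam-split (l.920–976) with the Γ₁/Γ₀ Petersson index
  `− v_p φ(N)` booked once (= the LEAD's `AFlatFamStatementR`, p806950 l.300–351, with `¬ split ↦ split`; nothing else differs).
* §1 GLUE (sorry-free).  S1⁺ ∧ (S2R at every admissible `(L, p)`) ⟹ `AFlatFamExcStatementR` — the LEAD's
  `katoBdpCrossingNonsplitFamilyR_of_bdvChainR_of_calibrationR` (p807901) with Step 2 run on the exceptional conjunct: the
  NON-exceptional conjunct at the calibrator (good ordinary, exact exponent by S2R) pins `V p d_L = 0`; the exceptional conjunct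
  at the target then IS A♭-fam-excR (`rw [bdvExplicitExponentExcR]`).  The same S1⁺ projects to S1R, so S1⁺ ∧ S2R also gives
  `AFlatFamStatementR` (`aFlatFamR_of_bdvChainExcR_of_calibrationR`): ONE calibration serves BOTH signs.  Pieces road through
  the LEAD's `eisensteinPeriodRatioValuationR_of_supply_of_portR`.  Anti-costume: `A♭-famR ∧ A♭-fam-excR ∧ S2bR ⟹ S1⁺` (`V = 0`).
* §1b THE NF ROAD (sorry-free).  S1⁺-NF `BdvChainExplicitExcNFR P := ∃ V, BdvChainCurveConjunctR V ∧ BdvChainCurveConjunctExcR V ∧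
  BdvChainNFConjunct P V` (the LEAD's S1-NF-on-R with the exceptional conjunct under the same `∃ V`); glue S1⁺-NF ∧ S2-NF ⟹
  A♭-fam-excR (port of `aFlatFamR_of_bdvChainNFR_of_calibrationNF`, Step 2 on the exceptional conjunct) AND ⟹ A♭-famR (projection);
  the registrable four-piece text `BdvCalibrationPiecesExcNFR := SUPPLY ∧ ∃ P, S1⁺-NF P ∧ REALISABILITY P ∧ BSTW P` (= r3's
  `BdvCalibrationPiecesNFR` with S1-NF strengthened to S1⁺-NF; projects onto it), with proved glues to A♭-fam-excR and A♭-famR.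
  The r3-SHAPED RECIPE for item 33168 is thereby in hand — stubs `stub_printedFactsHeldSplit` (S0′ text verbatim) ·
  `stub_calibratorSupplyNF` (r3's text verbatim) · `stub_portPiecesExcNFR : ∃ P, BdvChainExplicitExcNFR P ∧ CalibratorDataRealisableNF P ∧
  BstwIntegralPerrinRiouNF P` (⟹ r3's `stub_portPiecesNFR`), entry `katoValuationIneqSplitAtFive_of_piecesExcNFR stub₁ ⟨stub₂, stub₃⟩` —
  RECORDED ONLY: this seat registers nothing (W-79) and 33168 carries no skeleton by director ruling (558); keying it is the pen's call.
* §2 THE SPLIT DOOR ON R (sorry-free modulo the section hypothesis `hS0` = S0′, the 9-conjunction of printed facts that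
  `ErratumRoadFiveBstwDoorValuationIneqR` uses, SAME TEXT): `bstwCrossingExcFamilyR` (= `bstwCrossingNonsplitFamilyR` of p808053
  with the sign flipped — the abstract glue `bstwCrossing_of_normIdentity` is sign-free), `valuationIneqExcFamilyR_core`,
  `famValuationIneqSplit_of_aFlatFamExcR` (conclusion = the LEAD's FAMILY-LEVEL binder `hFamSplit` of
  `ErratumRoadFiveKatoFframeValueAtomsOfFamily.valuationIneqSplit_of_family`, ν-free: `v_p φ(N) ≥ 0` dropped by `linarith`), and
  the BY-NAME docks `katoValuationIneqSplitAtFive_of_aFlatFamExcR : S0′ → AFlatFamExcStatementR →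
  Theses.ErratumRoadFive.KatoValuationIneqSplitAtFive`, `…_of_stubsExcR` (S0′, S1⁺, S2R-family), `…_of_piecesExcR` (S0′, S1⁺, S2a,
  S2c, S2bR), `…_of_piecesExcNFR` (S0′, `BdvCalibrationPiecesExcNFR`) and `katoValuationIneq_bothSigns_of_stubsExcR ∕ _of_piecesExcR ∕
  _of_piecesExcNFR : S0′ → … → KatoValuationIneqSplitAtFive ∧ KatoValuationIneqNonsplitAtFive` — 404 pairs behind ONE research statement
  (S1⁺, resp. the `∃ P`-bundled S1⁺-NF ∧ port), the calibrator family (S2R, resp. the print-fed NF SUPPLY) and S0′.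

WHY THE g-ONLY CONSTANT IS SHARED (the lever; census F4′, first-hand from pp. 45–48).  BDV22 prove Theorem B at an
exceptional `p` as Thm. 5.1 ∧ Thm. 5.2 ∧ Lemma 4.6 (§5.3).  Thm. 5.1 (Beilinson–Flach vs Beilinson–Kato, via the IMPROVED classes
(39) and the improved Mazur–Kitagawa functions `L_p^*(f ⊗ χ)`, p. 46 L47–50, and a unit `C ∈ O_f` with `C(k_o)` «a non-zero
explicit element of K(a_n(f))», p. 46 L58) and Thm. 5.2 (Beilinson–Flach vs Heegner, via the improved class (41) and the factor
`(−1)^{k_o/2−1}(1 − p⁻¹)/(k_o/2 − 1)!`, p. 48 L22–24) both hold «up to multiplication by an explicit non-zero constant in the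
number field K(a_n(f))» (p. 46 L32–33, p. 47 L32–33; PREPRINT loci for holders of `paper:url-1c4826f4a331` (critic N1): Thm. 5.1
p. 38 L34–56, `C(k_o)` p. 39 L8, Thm. 5.2 p. 39 L23–43, §5.3 p. 40 L37–38), and the ONLY non-explicit scalar is `L(g)/log_p(u_p) ∈ ℚ^*` (Lemma 4.6),
attached to the CM Hida family `g` of `K` and to `p` alone — verbatim the §4 scalar absorbed by `V p d_L` in S1R.  So a
good-ordinary calibrator at `(K, p)` (S2R: BSTW24 Thm. 1.13 on R) kills the exceptional member's shift too.  No 𝓛-invariant of `f`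
enters (the exceptional zero sits in `g`'s Euler factor and in MK's analytic factor, both REMOVED by improvement, never
differentiated) — consistent with Venerucci 2016 Thm. A (`ℓ₁ ∈ ℚ^×`) and with `PAdicHeightNondegeneracy` being irrelevant here.

WHY IT MIGHT FAIL (the exceptional conjunct's own residues, census F4′ (ii)–(iii); nothing here values them): (R1⁺) `ord_p C(k_o)`
— `C(k_o)` is a FAMILY LIMIT at the split `p`-new point of the §4 scalars of the good classical specialisations `f_k` with the
analytic Euler factor `(1 − p^{k_o/2−1}/a_p(f_k))` split off (p. 46 L55–60); BDV call it explicit, its valuation is not displayed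
(source: Bertolini–Seveso–Venerucci, Astérisque 434 §5 — WANTED, not held); (c′_χ) the improved Mazur–Tate–Teitelbaum constant
`L_p^*(f ⊗ χ)(k_o)/L(f, χ, k_o/2)^{alg} ∈ ℚ(α)^*` (p. 47 L1–2), `χ = 1, ε_K`; (c1⁺) as S1's c1: no INTEGRAL form of Thm. 5.1/5.2 in
print — the port must value the improved three-variable reciprocity law at `(k_o, 1, k_o/2 − 1)` against integral classes.  The
leading `1` of `bdvExplicitExponentExcR` is the BSD-consistent value (door rev 3.9 l.874–890: A♯, B and the registered atom's right-hand
side `… − 1` force it); S1⁺ with any other leading integer contradicts S2R ∧ (p-part of BSD at the split member) on every `(K, p)`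
carrying a calibrator — that is the statement's content and its cheapest falsifier (one rank-one split pair `(E, p)` with BSTW-exact
calibrator and a computed Kato bottom class; none is computed here).

BOOKING CLAIM (rev 1.1; critic V386 P1, option (c) — the refutable content of the exceptional conjunct, stated so a refuter can aim
at it).  BDV's §5 identities hold «up to an explicit non-zero constant in K(a_n(f))» (Thm. 5.1) ∕ «in K(a_n(f_α))» (Thm. 5.2): these
are MEMBER-DEPENDENT rational scalars (for an elliptic curve `K(a_n(f)) = ℚ`) — the family-limit value `C(k_o)` of the unit `C ∈ O_f`
(p. 46 L55–60; preprint p. 39 L8), the improved Mazur–Tate–Teitelbaum constants `c_χ = L_p^*(f ⊗ χ)(k_o)/L(f, χ, k_o/2)^{alg}`,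
`χ = 1, ε_K` (p. 47 L1–6, `c_K ∈ K(a_n(f))^*`; of these `c_1` multiplies `L(f, k_o/2)^{alg} = 0` under Thm. 5.1's hypothesis and DROPS
OUT, p. 47 L3–5 — the LIVE member-dependent constants are `C(k_o)`, `c_{ε_K}` and the Thm. 5.2 constant), the Thm. 5.2 constant
(p. 47 L31–33) and (41)'s factor `(−1)^{k_o/2−1}(1 − p⁻¹)/(k_o/2 − 1)!`
(p. 48 L22–24, `p`-only, valuation `−1` at `k_o = 2`) — whereas the ONLY absorber of S1⁺, the shift `V p d_L`, is member-INDEPENDENT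
and is pinned to `0` by the non-exceptional calibrator (§1).  Hence `BdvChainCurveConjunctExcR V` ∕ S1⁺ ∕ S1⁺-NF INCLUDE, as part of
their content, the claim: «for every weight-2 trivial-character newform of an elliptic curve at a split multiplicative `p ≥ 5` with
`ρ̄` onto, the total `p`-adic valuation of the product of BDV §5's LIVE explicit constants (`C(k_o)`, `c_{ε_K}`, the Thm. 5.2 constant, the (41)-factor) is EXACTLY what
the displayed terms of `bdvExplicitExponentExcR` book — leading `1` included (relative to §4's booking `bdvExplicitExponentR` at a
non-split prime, certified equal resp. off by one in §0) — with NO further member-dependent correction».  This is the T0ι failure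
mode named in advance (a member-dependent explicit factor hidden under a uniform shift), here DECLARED rather than hidden: ONE split
pair `(E, p)` for which the improved-class constants have total valuation different from the booked one refutes S1⁺ AS TYPED.
Discharge routes (not taken here, nothing is valued): (a) PRINT — `ord_p C(k_o) = 0` and `ord_p c_χ = 0` in this weight-2,
trivial-character, split-multiplicative range from Bertolini–Seveso–Venerucci (Astérisque 434, §5; acq-14925, WANTED, not held) and
the Greenberg–Stevens improved `p`-adic L-function [cite: GreenbergStevens1993, §3–§4]; (b) BOOK — if print displays a non-zero but
explicit valuation, add it as a further term of `bdvExplicitExponentExcR` in a successor rev (as F1 booked `ι_N` by `v_p φ(N)`); the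
registered atom's BSD-forced right-hand side `… − 1` then decides whether the exceptional door survives (the leading `1` is the ONLY
value consistent with S2R ∧ the `p`-part of BSD at the split member, next paragraph).

NOT PURSUED (recorded dead or engine-less in door rev 3.9 l.891–919 and card `Ideas/kato-bottom-layer-exczero.md` rev 1.8): (E1) derived
Beilinson–Flach ∕ generalized Kato classes at the exceptional point (Rivero–Rotger; Rivero arXiv:2103.00987) — no anticyclotomic-CM
instance in print; (E2-α) Venerucci 2016 Thm. A — needs an auxiliary INERT Steinberg set, excluded on this class by the crux's name;
BSTW §6.2.1 at `a_p = +1` — the comparison factor vanishes and Perrin-Riou's big-logarithm factor has a pole (`0 = 0` ∕ `∞·0`).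
BDV22 §5 is the (E2) road WITHOUT an inert set: classical `X_0(N)`, Heegner `K` with every prime of `pN` split.

STATUS.  NOTHING here is unconditional and NO registered stub, crux, route item or summit statement is proved: S1⁺, S2R (and
its pieces), S1⁺-NF, the NF SUPPLY ∕ REALISABILITY ∕ BSTW pieces and S0′'s nine facts are HYPOTHESES of every entry point; items
33168, 33169, 19715 stay OPEN; the registries of 19715 (r5.7 `f297f72a3565a6d8`) and 33169 (r3 `24679077dd891ca9`) are untouched and
33168 has none; typed ≠ proved; BSD is proved for no curve.

[cite: BertoliniDarmonVenerucci2022, §5: Thm. 5.1 (p. 46), Thm. 5.2 (p. 47), (39)–(41), §5.3 (p. 48); §4 (38) and Lemma 4.6 (pp. 44–45)]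
[cite: BurungaleSkinnerTianWan2024, Thm. 1.13 and §6.2.1 (86)–(94), p. 60] [cite: KingsLoefflerZerbes2017, Thm. 2.7.4]
[cite: Kato2004Asterisque, Thm. 12.5 (1) (pp. 221–222), Ex. 13.3 (p. 225), Lemma 13.10 (1) (p. 230)]
[cite: KrausOesterle1992, §3 Lemme 1, p. 262] [cite: Venerucci2016, Thm. A and (α), arXiv:1407.1913 pp. 3, 9]
[cite: Castella2018Exceptional, Thms. 2.10–2.11 (arXiv:1507.04260 pp. 13–14)] [cite: GreenbergStevens1993]
-/

set_option autoImplicit false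
-- D-0017: single-problem summit, so `Summit.BirchSwinnertonDyer.BirchSwinnertonDyer.…` repeats a namespace BY DESIGN.
set_option linter.dupNamespace false

noncomputable section

open scoped Classical NumberField TensorProduct BigOperators

namespace Summit.BirchSwinnertonDyer.BirchSwinnertonDyer.Cruxes.EulerHalfNotRamNoInertSetAtFive.BdvCalibrationExc

open Field
open Literature.NumberTheory.GaloisRepresentations
open Literature.NumberTheory.EllipticCurves Literature.NumberTheory.EllipticCurves.Kato2004
open Literature.NumberTheory.EllipticCurves.Kato2004.EulerSystemValues
open Literature.NumberTheory.EllipticCurves.Rank1Residual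
open Literature.NumberTheory.EllipticCurves.Rank1Residual.Typed
open Literature.NumberTheory.EllipticCurves.ModularForms
open Literature.NumberTheory.EllipticCurves.Castella2018
open Summit.BirchSwinnertonDyer.Rank1Residual
open Summit.BirchSwinnertonDyer.BirchSwinnertonDyer.Theorems
open Summit.BirchSwinnertonDyer.BirchSwinnertonDyer.Theorems.ErratumRoadFiveBdvCalibrationSplit
open Summit.BirchSwinnertonDyer.BirchSwinnertonDyer.Theorems.ErratumRoadFiveBdvCalibrationSplitR
open Summit.BirchSwinnertonDyer.BirchSwinnertonDyer.Theorems.ErratumRoadFiveBdvCalibrationSplitNF (BdvChainCurveConjunctR NFPort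
  NFCalibratorDatum BdvChainNFConjunct BdvChainExplicitNFR EisensteinPeriodRatioValuationNF CalibratorSupplyNF
  CalibratorDataRealisableNF BstwIntegralPerrinRiouNF BdvCalibrationPiecesNFR aFlatFamR_of_bdvCalibrationPiecesNFR
  eisensteinPeriodRatioValuationNF_of_supply_of_port bdvChainExplicitNonsplitR_of_bdvChainExplicitNFR
  aFlatFamR_of_bdvChainNFR_of_calibrationNF)
open Summit.BirchSwinnertonDyer.BirchSwinnertonDyer.Theorems.ErratumRoadFiveBstwDoor
open IsDedekindDomain (HeightOneSpectrum)
open CongruenceSubgroup (Gamma0)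

/-! ## §0 Vocabulary: the exceptional exponent, the exceptional class, the exceptional curve conjunct, S1⁺, A♭-fam-excR -/

/-- The EXPLICIT crossing exponent at an EXCEPTIONAL (split multiplicative) prime, on the amended (R) bookkeeping:
`1 + ord_p c − ord_p s − ord_p k − (ord_p r_f − ord_p m_f) − v_p φ(N) − v`.  Leading integer `1` = the value the sign-free
halves A♯ (`bdpFrameValue`, `ord_p(1 − a_p p⁻¹) = −1` for `a_p = ±1`) and B force on the equality case of the registered split
atom (door rev 3.9 l.874–890); it is NOT `bdvExplicitExponentR p a_p …` at `a_p = +1` (`bdvExplicitExponentR_eq_excR_sub_one_of_split`).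
Arguments as `bdvExplicitExponentR` without `ap`. [cite: BertoliniDarmonVenerucci2022, §5 Thm. 5.2 and p. 48 L22–24]
[cite: KingsLoefflerZerbes2017, Thm. 2.7.4] -/
def bdvExplicitExponentExcR (p : ℕ) (c : ℤ) (s : ℚ) (k : ℤ) (rf m : ℕ) (v : ℤ) (N : ℕ) : ℤ :=
  1 + padicValInt p c - padicValRat p s - padicValInt p k - ((padicValNat p rf : ℤ) - padicValNat p m) -
    (padicValNat p (Nat.totient N) : ℤ) - v

/-- ONE EXPONENT FOR BOTH MULTIPLICATIVE SIGNS: at a NON-split multiplicative `p ≥ 5` (`a_p = −1`, [KO92, Lemme 1]) the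
registered amended exponent `bdvExplicitExponentR p a_p …` equals the exceptional one (the LEAD's
`bdvExplicitExponentR_of_not_split`, p806950). [cite: KrausOesterle1992, §3 Lemme 1, p. 262] -/
theorem bdvExplicitExponentR_eq_excR_of_not_split (W : WeierstrassCurve ℚ) [W.IsElliptic] (p : ℕ) [Fact p.Prime]
    (hm : Mult W p) (hns : ¬ W.HasSplitMultiplicativeReductionAtPrime p) (h5 : 5 ≤ p)
    (c : ℤ) (s : ℚ) (k : ℤ) (rf m : ℕ) (v : ℤ) (N : ℕ) :
    bdvExplicitExponentR p (W.LFunction p) c s k rf m v N = bdvExplicitExponentExcR p c s k rf m v N := by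
  rw [bdvExplicitExponentR_of_not_split W p hm hns h5, bdvExplicitExponentExcR]

/-- THE REGISTERED FORMULA IS OFF BY ONE AT A SPLIT PRIME: at a split multiplicative `p` (`a_p = +1`, [KO92, Lemme 1]) the
good-reduction `a_p`-term `1 − v_p(p + 1 − a_p)` of `bdvExplicitExponent` reads `1 − v_p(p) = 0`, so `bdvExplicitExponentR p a_p …`
is the exceptional exponent MINUS ONE — the reason the exceptional conjunct carries its own constant and S1R's class
`NonExceptionalRankOneAt` excludes split `p`. [cite: KrausOesterle1992, §3 Lemme 1, p. 262] -/
theorem bdvExplicitExponentR_eq_excR_sub_one_of_split (W : WeierstrassCurve ℚ) [W.IsElliptic] (p : ℕ) [Fact p.Prime]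
    (hsp : W.HasSplitMultiplicativeReductionAtPrime p) (c : ℤ) (s : ℚ) (k : ℤ) (rf m : ℕ) (v : ℤ) (N : ℕ) :
    bdvExplicitExponentR p (W.LFunction p) c s k rf m v N = bdvExplicitExponentExcR p c s k rf m v N - 1 := by
  have ha : W.LFunction p = 1 :=
    KrausOesterle1992.lFunction_apply_prime_eq_one_of_hasSplitMultiplicativeReductionAtPrime W p hsp
  have h1 : padicValInt p ((p : ℤ) + 1 - W.LFunction p) = 1 := by
    rw [ha, add_sub_cancel_right, padicValInt_self]
  rw [bdvExplicitExponentR, bdvExplicitExponent, h1, bdvExplicitExponentExcR, petIndexVal]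
  ring

/-- The `p`-EXCEPTIONAL RANK-ONE class of [BDV22, §5]: analytic rank `1`, `E[p]` irreducible, and `p` of (split) multiplicative
reduction with `a_p = +1` («f = f_α is new at p and a_p(f) = α = p^{k_o/2−1}», §5 p. 45 L47–49) — the complement of
`NonExceptionalRankOneAt` among the semistable-at-`p` rank-one pairs.  The split members of class X11b are exactly
`ClassX11b ∧ split` (`exceptionalRankOneAt_of_classX11b`). [cite: BertoliniDarmonVenerucci2022, §5, p. 45] -/
def ExceptionalRankOneAt (W : WeierstrassCurve ℚ) [W.IsElliptic] [W.IsGloballyMinimal] (p : ℕ) [Fact p.Prime] : Prop :=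
  W.analyticRank = 1 ∧ Irr W p ∧ Mult W p ∧ W.HasSplitMultiplicativeReductionAtPrime p

/-- A class-X11b pair which is SPLIT at `p` is `p`-exceptional. -/
theorem exceptionalRankOneAt_of_classX11b (W : WeierstrassCurve ℚ) [W.IsElliptic] [W.IsGloballyMinimal]
    (p : ℕ) [Fact p.Prime] (hX : ClassX11b W p) (hsp : W.HasSplitMultiplicativeReductionAtPrime p) :
    ExceptionalRankOneAt W p :=
  ⟨hX.1, hX.2.2.2, hX.2.2.1, hsp⟩

/-- The two BDV classes are disjoint (no pair is both exceptional and non-exceptional at `p`: `GoodOrd` excludes `Mult`). -/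
theorem not_nonExceptionalRankOneAt_of_exceptional (W : WeierstrassCurve ℚ) [W.IsElliptic] [W.IsGloballyMinimal]
    (p : ℕ) [Fact p.Prime] (h : ExceptionalRankOneAt W p) : ¬ NonExceptionalRankOneAt W p := by
  rintro ⟨-, -, ⟨-, hns⟩ | hgo⟩
  · exact hns h.2.2.2
  · have hg : ((W.baseChange ℚ_[p]).minimal ℤ_[p]).HasGoodReduction ℤ_[p] := hgo.1
    have hm : ((W.baseChange ℚ_[p]).minimal ℤ_[p]).HasMultiplicativeReduction ℤ_[p] := h.2.2.1
    exact WeierstrassCurve.HasGoodReduction.not_hasMultiplicativeReduction ℤ_[p] hg hm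

/-- **The EXCEPTIONAL CURVE CONJUNCT at a shift `V` — BDV22 §5 (Thm. 5.1 ∧ Thm. 5.2 ∧ Lemma 4.6) VALUED up to the g-only
constant `L(g)/log_p(u_p)`:** the NF-port's `BdvChainCurveConjunctR V` (p809716, §0) VERBATIM with `NonExceptionalRankOneAt ↦
ExceptionalRankOneAt` and the exponent `bdvExplicitExponentR p a_p … N ↦ bdvExplicitExponentExcR p … N`: for every
`p`-exceptional rank-one pair with `ρ̄` onto, every admissible Heegner field `L` (split at `p` and at `N`, `d_L < −4` odd,
`L(E^{(d_L)}, 1) ≠ 0`), datum `Dt` with `p ∤ c`, descent scalars `(s, k)`, minimal datum `D`, value-pinned Kato family with lift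
`y` and period ratio `λ`, BDP frame with value `X` at `𝟙` and Kummer logarithm `σ ≠ 0` of the bottom class of `y`:
`‖X‖ = p^{bdvExplicitExponentExcR(…) − V p d_L}`.  Why it might fail: residues (R1⁺) `ord_p C(k_o)`, (c′_χ), (c1⁺) of the module
docstring — none valued here.  BOOKING CLAIM (rev 1.1, critic V386 P1(c)): this conjunct INCLUDES the claim that the total `p`-adic
valuation of BDV §5's MEMBER-DEPENDENT explicit constants — `C(k_o)`, `c_{ε_K}` (Thm. 5.1; `c_1` multiplies `L(f, k_o/2)^{alg} = 0`
and drops out), the Thm. 5.2 constant, and (41)'s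
`(−1)^{k_o/2−1}(1 − p⁻¹)/(k_o/2 − 1)!` — is EXACTLY what the displayed terms of `bdvExplicitExponentExcR` book (leading `1` included), with
NO further member-dependent correction (the shift `V p d_L` is member-independent and calibrator-pinned); one split pair `(E, p)` whose
improved-class constants (BSV, Astérisque 434 §5 — acq-14925) total a different valuation refutes it as typed. [cite: BertoliniDarmonVenerucci2022, §5 Thm. 5.1 (p. 46 L11–33), Thm. 5.2 (p. 47 L13–33), §5.3 (p. 48 L38–40), Lemma 4.6 (p. 44–45)]
[cite: Kato2004Asterisque, Thm. 12.5 (1) (pp. 221–222)] [cite: KingsLoefflerZerbes2017, Thm. 2.7.4] -/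
def BdvChainCurveConjunctExcR (V : ℕ → ℤ → ℤ) : Prop :=
    ∀ (W : WeierstrassCurve ℚ) [W.IsElliptic] [W.IsGloballyMinimal] (p : ℕ) [Fact p.Prime]
      [ContinuousSMul ℤ_[p] (W.tateModule p)] [Module.Free ℤ_[p] (W.tateModule p)]
      [Module.Finite ℤ_[p] (W.tateModule p)] [NeZero (W.conductorNorm ℤ)],
      ExceptionalRankOneAt W p → 5 ≤ p → Surj W p →
      ∀ (L : Type) [Field L] [NumberField L], IsImaginaryQuadratic L →
        SatisfiesHeegnerHypothesis (W.conductorNorm ℤ) L → SatisfiesHeegnerHypothesis p L →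
        NumberField.discr L < -4 → Odd (NumberField.discr L) →
        (W.quadraticTwist (NumberField.discr L : ℚ)).entireLFunction 1 ≠ 0 →
      ∀ (Dt : ModularParametrizationData W (W.conductorNorm ℤ))
        (Hd : HeegnerDatum (W.conductorNorm ℤ) (NumberField.discr L)) (w₀ : NumberField.InfinitePlace L)
        (PL : (W.baseChange L).toAffine.Point),
        WeierstrassCurve.Affine.Point.map w₀.embedding.toRatAlgHom PL = heegnerPointComplex Dt Hd →
        ¬ (p : ℤ) ∣ Dt.c →
      ∀ (s : ℚ) (k : ℤ),
        (Real.sqrt ((NumberField.discr L).natAbs : ℝ) : ℂ) *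
            (W.quadraticTwist (NumberField.discr L : ℚ)).entireLFunction 1 = (s : ℂ) * (minusPeriod Dt.f : ℂ) →
        (Dt.c : ℝ) * minusPeriod Dt.f = k * W.imaginaryPeriodRat →
      ∀ (W' : WeierstrassCurve ℚ) [W'.IsElliptic] (D : ModularParametrizationData W' (W.conductorNorm ℤ)),
        D.f = Dt.f →
        (∀ (W'' : WeierstrassCurve ℚ) [W''.IsElliptic] (D'' : ModularParametrizationData W'' (W.conductorNorm ℤ)),
            D''.f = D.f → D.modularDegree ≤ D''.modularDegree) →
      ∀ (K : ZpExtension ℚ p) (hK : K.IsCyclotomic) (γ : absoluteGaloisGroup ℚ)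
        (I : IwasawaH1Data W p K γ), K.IsTopGenerator γ →
      ∀ (hp : p ≠ 2) (N : ℕ) [NeZero N] (f : CuspForm (Gamma0 N) 2), IsNewformOf W f →
      ∀ (ι : (n : ℕ) → (CyclotomicField n ℚ →+* ℂ)) (q : ℚ)
        (Λ : ∀ (m : ℕ) (r : Finset (HeightOneSpectrum (𝓞 ℚ))),
          H1 (tateRep W p) (cycSubgroup p m r) →ₗ[ℤ_[p]] ℚ_[p] ⊗[ℚ] CyclotomicField (cycLevel p m r) ℚ)
        (c d₁ a : ℤ) (A : ℕ) (d' : ℤ)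
        (z : ∀ (m : ℕ) (r : (cyclotomicLevelsRat p (badPlaces c d₁ A N)).Ideals),
          H1 (tateRep W p) ((cyclotomicLevelsRat p (badPlaces c d₁ A N)).level m r.1))
        (x : ∀ (m : ℕ) (r : (cyclotomicLevelsRat p (badPlaces c d₁ A N)).Ideals),
          CyclotomicField (cycLevel p m r.1) ℚ)
        (y : I.H) (perRatio : ℚ),
        q ≠ 0 → ZetaBody W p f ι ((q : ℚ) : ℝ) Λ c d₁ a A z x →
        (∀ n : ℕ, I.proj n y =
          levelToLayer W p hK hp (badPlaces c d₁ A N) n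
            (z (n + 1) (cyclotomicLevelsRat p (badPlaces c d₁ A N)).idealOne)) →
        0 < A → Int.gcd c (6 * p * A) = 1 → Int.gcd d₁ (6 * p * N) = 1 → (d₁ : ℤ) * d' ≡ 1 [ZMOD (A : ℤ)] →
        ratCuspFactor f true c d₁ a A d' ≠ 0 → perRatio ≠ 0 →
        plusPeriod f = ((perRatio : ℚ) : ℝ) * W.realPeriodRat →
      ∀ (ι' : PadicAlgCl p ≃+* ℂ)
        (κ : ZpExtension L p) (γ' : absoluteGaloisGroup L) (ΩK : ℂ) (Ωp : (unrIntegers p)ˣ) (Λf : UnrSeries p),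
        κ.IsAnticyclotomic → κ.IsTopGenerator γ' → ΩK ≠ 0 →
        IsBDPLFunction ι' (X11b.primeOfEmbeddingDatum p ι' w₀.embedding) κ γ' Dt.f ΩK
          ((Ωp : unrIntegers p) : ℂ_[p]) Λf →
      ∀ (X : ℂ_[p]), Λf.HasValueAt 0 X →
      ∀ σ : ℚ_[p], HasLocPKummerLog W p (bottomClass W p K I y) σ → σ ≠ 0 →
        ‖X‖ = (p : ℝ) ^ (bdvExplicitExponentExcR p Dt.c s k (congruenceNumber Dt.f) D.modularDegree
            (σ.valuation + padicValRat p (perRatio /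
              (q * ratCuspFactor f true c d₁ a A d' * ∏ ℓ ∈ A.primeFactors.erase p, eulerFactorAtOne W N ℓ))) N -
            V p (NumberField.discr L))

/-- **S1⁺ — `BdvChainExplicitExcR`: BDV22 §4 AND §5 valued up to ONE g-only constant.**  There is ONE shift function
`V : ℕ → ℤ → ℤ` such that the NON-exceptional curve conjunct `BdvChainCurveConjunctR V` (= S1R's body; `BdvChainExplicitNonsplitR ↔
∃ V, BdvChainCurveConjunctR V` is `Iff.rfl`) AND the exceptional curve conjunct `BdvChainCurveConjunctExcR V` hold.  Sharing `V`
is in print: Thm. 5.1 uses «L(g) in L^* as in Section 4.6» (p. 46 L11–12) and Lemma 4.6 is quoted unchanged in §5.3.  S1⁺ ⟹ S1R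
(first conjunct); S1⁺ ∧ S2R ⟹ A♭-fam-excR ∧ A♭-famR (§1).  Why it might fail: S1R's c1/c3 and the exceptional residues R1⁺, c′_χ, c1⁺ —
sharpened (rev 1.1, V386 P1(c)) to the BOOKING CLAIM of the module docstring: BDV's §5 explicit constants are MEMBER-dependent, `V` is
not, so S1⁺ ASSERTS their total valuation is the booked one (T0ι failure mode, declared); discharge by (a) BSV Astérisque 434 §5 ∕
Greenberg–Stevens (cite `ord_p = 0`) or (b) booking an explicit print valuation as a further exponent term in a successor rev.
[cite: BertoliniDarmonVenerucci2022, §4 (38), Lemma 4.6, §5 Thm. 5.1–5.2, pp. 44–48] -/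
@[conjecture]
def BdvChainExplicitExcR : Prop :=
  ∃ V : ℕ → ℤ → ℤ, BdvChainCurveConjunctR V ∧ BdvChainCurveConjunctExcR V

/-- S1⁺ projects to S1R (the non-exceptional conjunct; `BdvChainExplicitNonsplitR`'s body is `∃ V, BdvChainCurveConjunctR V`
definitionally — the one-constant rule of d2R P2). -/
theorem bdvChainExplicitNonsplitR_of_excR (h : BdvChainExplicitExcR) : BdvChainExplicitNonsplitR := by
  obtain ⟨V, hV, -⟩ := h
  exact ⟨V, hV⟩

/-- **`AFlatFamExcStatementR` — A♭-fam-split ON R**: door rev 3.9's fourth stub `stub_katoBdpCrossingSplitFamily` (l.920–976: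
A♭-fam's text with `¬ split ↦ split`, SAME exponent) with the Γ₁/Γ₀ Petersson index `− v_p φ(N)` booked once right after the Γ₀
pair — i.e. the LEAD's `AFlatFamStatementR` (p806950 l.300–351) with `¬ W.HasSplitMultiplicativeReductionAtPrime p ↦
W.HasSplitMultiplicativeReductionAtPrime p` and NOTHING else changed.  OPEN (research); implies the ν-free atom
`KatoValuationIneqSplitAtFive` modulo S0′ with slack `ν ≥ 0` (§2).
[cite: Kato2004Asterisque, Thm. 12.5, p. 229] [cite: BurungaleSkinnerTianWan2024, Thm. 1.1, p. 3] [cite: KingsLoefflerZerbes2017, Thm. 2.7.4]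
[cite: Castella2018Exceptional, Thms. 2.10–2.11 (arXiv:1507.04260 pp. 13–14)] -/
@[conjecture]
def AFlatFamExcStatementR : Prop :=
    ∀ (W : WeierstrassCurve ℚ) [W.IsElliptic] [W.IsGloballyMinimal] (p : ℕ) [Fact p.Prime]
      [ContinuousSMul ℤ_[p] (W.tateModule p)] [Module.Free ℤ_[p] (W.tateModule p)]
      [Module.Finite ℤ_[p] (W.tateModule p)] [NeZero (W.conductorNorm ℤ)],
      ClassX11b W p → 5 ≤ p → Surj W p → W.HasSplitMultiplicativeReductionAtPrime p →
      ∀ (L : Type) [Field L] [NumberField L], IsImaginaryQuadratic L →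
        SatisfiesHeegnerHypothesis (W.conductorNorm ℤ) L → SatisfiesHeegnerHypothesis p L →
        NumberField.discr L < -4 → Odd (NumberField.discr L) →
        (W.quadraticTwist (NumberField.discr L : ℚ)).entireLFunction 1 ≠ 0 →
      ∀ (Dt : ModularParametrizationData W (W.conductorNorm ℤ))
        (Hd : HeegnerDatum (W.conductorNorm ℤ) (NumberField.discr L)) (w₀ : NumberField.InfinitePlace L)
        (PL : (W.baseChange L).toAffine.Point),
        WeierstrassCurve.Affine.Point.map w₀.embedding.toRatAlgHom PL = heegnerPointComplex Dt Hd →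
        ¬ (p : ℤ) ∣ Dt.c →
      ∀ (s : ℚ) (k : ℤ),
        (Real.sqrt ((NumberField.discr L).natAbs : ℝ) : ℂ) *
            (W.quadraticTwist (NumberField.discr L : ℚ)).entireLFunction 1 = (s : ℂ) * (minusPeriod Dt.f : ℂ) →
        (Dt.c : ℝ) * minusPeriod Dt.f = k * W.imaginaryPeriodRat →
      ∀ (W' : WeierstrassCurve ℚ) [W'.IsElliptic] (D : ModularParametrizationData W' (W.conductorNorm ℤ)),
        D.f = Dt.f →
        (∀ (W'' : WeierstrassCurve ℚ) [W''.IsElliptic] (D'' : ModularParametrizationData W'' (W.conductorNorm ℤ)),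
            D''.f = D.f → D.modularDegree ≤ D''.modularDegree) →
      ∀ (K : ZpExtension ℚ p) (hK : K.IsCyclotomic) (γ : absoluteGaloisGroup ℚ)
        (I : IwasawaH1Data W p K γ), K.IsTopGenerator γ →
      ∀ (hp : p ≠ 2) (N : ℕ) [NeZero N] (f : CuspForm (Gamma0 N) 2), IsNewformOf W f →
      ∀ (ι : (n : ℕ) → (CyclotomicField n ℚ →+* ℂ)) (q : ℚ)
        (Λ : ∀ (m : ℕ) (r : Finset (HeightOneSpectrum (𝓞 ℚ))),
          H1 (tateRep W p) (cycSubgroup p m r) →ₗ[ℤ_[p]] ℚ_[p] ⊗[ℚ] CyclotomicField (cycLevel p m r) ℚ)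
        (c d₁ a : ℤ) (A : ℕ) (d' : ℤ)
        (z : ∀ (m : ℕ) (r : (cyclotomicLevelsRat p (badPlaces c d₁ A N)).Ideals),
          H1 (tateRep W p) ((cyclotomicLevelsRat p (badPlaces c d₁ A N)).level m r.1))
        (x : ∀ (m : ℕ) (r : (cyclotomicLevelsRat p (badPlaces c d₁ A N)).Ideals),
          CyclotomicField (cycLevel p m r.1) ℚ)
        (y : I.H) (perRatio : ℚ),
        q ≠ 0 → ZetaBody W p f ι ((q : ℚ) : ℝ) Λ c d₁ a A z x →
        (∀ n : ℕ, I.proj n y =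
          levelToLayer W p hK hp (badPlaces c d₁ A N) n
            (z (n + 1) (cyclotomicLevelsRat p (badPlaces c d₁ A N)).idealOne)) →
        0 < A → Int.gcd c (6 * p * A) = 1 → Int.gcd d₁ (6 * p * N) = 1 → (d₁ : ℤ) * d' ≡ 1 [ZMOD (A : ℤ)] →
        ratCuspFactor f true c d₁ a A d' ≠ 0 → perRatio ≠ 0 →
        plusPeriod f = ((perRatio : ℚ) : ℝ) * W.realPeriodRat →
      ∀ (ι' : PadicAlgCl p ≃+* ℂ)
        (κ : ZpExtension L p) (γ' : absoluteGaloisGroup L) (ΩK : ℂ) (Ωp : (unrIntegers p)ˣ) (Λf : UnrSeries p),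
        κ.IsAnticyclotomic → κ.IsTopGenerator γ' → ΩK ≠ 0 →
        IsBDPLFunction ι' (X11b.primeOfEmbeddingDatum p ι' w₀.embedding) κ γ' Dt.f ΩK
          ((Ωp : unrIntegers p) : ℂ_[p]) Λf →
      ∀ (X : ℂ_[p]), Λf.HasValueAt 0 X →
      ∀ σ : ℚ_[p], HasLocPKummerLog W p (bottomClass W p K I y) σ → σ ≠ 0 →
        ‖X‖ = (p : ℝ) ^ (1 + padicValInt p Dt.c - padicValRat p s - padicValInt p k -
            ((padicValNat p (congruenceNumber Dt.f) : ℤ) - padicValNat p D.modularDegree) -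
            (padicValNat p (Nat.totient N) : ℤ) -
            (σ.valuation + padicValRat p (perRatio /
              (q * ratCuspFactor f true c d₁ a A d' * ∏ ℓ ∈ A.primeFactors.erase p, eulerFactorAtOne W N ℓ))))

/-! ## §1 Glue (sorry-free): S1⁺ ∧ S2R ⟹ A♭-fam-excR (and A♭-famR); the pieces road; the anti-costume direction -/

/-- **The proved recomposition at the EXCEPTIONAL sign, on the amended exponent.**  Conclusion = `AFlatFamExcStatementR` unfolded.
Proof = the LEAD's `katoBdpCrossingNonsplitFamilyR_of_bdvChainR_of_calibrationR` (p807901) with Step 2 run on the exceptional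
conjunct: S2R at `(L, p)` yields a good-ordinary calibrator with exact exponent `e′_R`; the NON-exceptional conjunct at the calibrator
yields `e′_R − V p d_L` for the same norm; `p^·` is injective, so `V p d_L = 0`; the EXCEPTIONAL conjunct at the target (a member of
`ExceptionalRankOneAt` by `exceptionalRankOneAt_of_classX11b`) gives the A♭-fam-excR exponent (`rw [bdvExplicitExponentExcR]`).
[cite: BertoliniDarmonVenerucci2022, §5.3 (p. 48) and Lemma 4.6 (p. 44–45)] [cite: BurungaleSkinnerTianWan2024, Thm. 1.13] -/
theorem katoBdpCrossingExcFamilyR_of_bdvChainExcR_of_calibrationR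
    (h₁ : BdvChainExplicitExcR)
    (h₂ : ∀ (p : ℕ) [Fact p.Prime], 5 ≤ p → ∀ (L : Type) [Field L] [NumberField L],
      IsImaginaryQuadratic L → SatisfiesHeegnerHypothesis p L → NumberField.discr L < -4 →
      Odd (NumberField.discr L) → EisensteinPeriodRatioValuationR L p) :
    ∀ (W : WeierstrassCurve ℚ) [W.IsElliptic] [W.IsGloballyMinimal] (p : ℕ) [Fact p.Prime]
      [ContinuousSMul ℤ_[p] (W.tateModule p)] [Module.Free ℤ_[p] (W.tateModule p)]
      [Module.Finite ℤ_[p] (W.tateModule p)] [NeZero (W.conductorNorm ℤ)],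
      ClassX11b W p → 5 ≤ p → Surj W p → W.HasSplitMultiplicativeReductionAtPrime p →
      ∀ (L : Type) [Field L] [NumberField L], IsImaginaryQuadratic L →
        SatisfiesHeegnerHypothesis (W.conductorNorm ℤ) L → SatisfiesHeegnerHypothesis p L →
        NumberField.discr L < -4 → Odd (NumberField.discr L) →
        (W.quadraticTwist (NumberField.discr L : ℚ)).entireLFunction 1 ≠ 0 →
      ∀ (Dt : ModularParametrizationData W (W.conductorNorm ℤ))
        (Hd : HeegnerDatum (W.conductorNorm ℤ) (NumberField.discr L)) (w₀ : NumberField.InfinitePlace L)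
        (PL : (W.baseChange L).toAffine.Point),
        WeierstrassCurve.Affine.Point.map w₀.embedding.toRatAlgHom PL = heegnerPointComplex Dt Hd →
        ¬ (p : ℤ) ∣ Dt.c →
      ∀ (s : ℚ) (k : ℤ),
        (Real.sqrt ((NumberField.discr L).natAbs : ℝ) : ℂ) *
            (W.quadraticTwist (NumberField.discr L : ℚ)).entireLFunction 1 = (s : ℂ) * (minusPeriod Dt.f : ℂ) →
        (Dt.c : ℝ) * minusPeriod Dt.f = k * W.imaginaryPeriodRat →
      ∀ (W' : WeierstrassCurve ℚ) [W'.IsElliptic] (D : ModularParametrizationData W' (W.conductorNorm ℤ)),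
        D.f = Dt.f →
        (∀ (W'' : WeierstrassCurve ℚ) [W''.IsElliptic] (D'' : ModularParametrizationData W'' (W.conductorNorm ℤ)),
            D''.f = D.f → D.modularDegree ≤ D''.modularDegree) →
      ∀ (K : ZpExtension ℚ p) (hK : K.IsCyclotomic) (γ : absoluteGaloisGroup ℚ)
        (I : IwasawaH1Data W p K γ), K.IsTopGenerator γ →
      ∀ (hp : p ≠ 2) (N : ℕ) [NeZero N] (f : CuspForm (Gamma0 N) 2), IsNewformOf W f →
      ∀ (ι : (n : ℕ) → (CyclotomicField n ℚ →+* ℂ)) (q : ℚ)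
        (Λ : ∀ (m : ℕ) (r : Finset (HeightOneSpectrum (𝓞 ℚ))),
          H1 (tateRep W p) (cycSubgroup p m r) →ₗ[ℤ_[p]] ℚ_[p] ⊗[ℚ] CyclotomicField (cycLevel p m r) ℚ)
        (c d₁ a : ℤ) (A : ℕ) (d' : ℤ)
        (z : ∀ (m : ℕ) (r : (cyclotomicLevelsRat p (badPlaces c d₁ A N)).Ideals),
          H1 (tateRep W p) ((cyclotomicLevelsRat p (badPlaces c d₁ A N)).level m r.1))
        (x : ∀ (m : ℕ) (r : (cyclotomicLevelsRat p (badPlaces c d₁ A N)).Ideals),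
          CyclotomicField (cycLevel p m r.1) ℚ)
        (y : I.H) (perRatio : ℚ),
        q ≠ 0 → ZetaBody W p f ι ((q : ℚ) : ℝ) Λ c d₁ a A z x →
        (∀ n : ℕ, I.proj n y =
          levelToLayer W p hK hp (badPlaces c d₁ A N) n
            (z (n + 1) (cyclotomicLevelsRat p (badPlaces c d₁ A N)).idealOne)) →
        0 < A → Int.gcd c (6 * p * A) = 1 → Int.gcd d₁ (6 * p * N) = 1 → (d₁ : ℤ) * d' ≡ 1 [ZMOD (A : ℤ)] →
        ratCuspFactor f true c d₁ a A d' ≠ 0 → perRatio ≠ 0 →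
        plusPeriod f = ((perRatio : ℚ) : ℝ) * W.realPeriodRat →
      ∀ (ι' : PadicAlgCl p ≃+* ℂ)
        (κ : ZpExtension L p) (γ' : absoluteGaloisGroup L) (ΩK : ℂ) (Ωp : (unrIntegers p)ˣ) (Λf : UnrSeries p),
        κ.IsAnticyclotomic → κ.IsTopGenerator γ' → ΩK ≠ 0 →
        IsBDPLFunction ι' (X11b.primeOfEmbeddingDatum p ι' w₀.embedding) κ γ' Dt.f ΩK
          ((Ωp : unrIntegers p) : ℂ_[p]) Λf →
      ∀ (X : ℂ_[p]), Λf.HasValueAt 0 X →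
      ∀ σ : ℚ_[p], HasLocPKummerLog W p (bottomClass W p K I y) σ → σ ≠ 0 →
        ‖X‖ = (p : ℝ) ^ (1 + padicValInt p Dt.c - padicValRat p s - padicValInt p k -
            ((padicValNat p (congruenceNumber Dt.f) : ℤ) - padicValNat p D.modularDegree) -
            (padicValNat p (Nat.totient N) : ℤ) -
            (σ.valuation + padicValRat p (perRatio /
              (q * ratCuspFactor f true c d₁ a A d' * ∏ ℓ ∈ A.primeFactors.erase p, eulerFactorAtOne W N ℓ)))) := by
  intro W _ _ p _ _ _ _ _ hX h5 hS hsp L _ _ hLq hH hHp hd4 hodd hLt Dt Hd w₀ PL hPL hc s k hs hk W' _ D hDf hmin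
    K hK γ I hγ hp N _ f hf ι q Λ c d₁ a A d' z x y perRatio hq hzeta hy hA hcg hd hdd' hR hper0 hper
    ι' κ γ' ΩK Ωp Λf hκ hγ' hΩK hBDP X hXv σ hσ hσ0
  obtain ⟨V, hV, hVx⟩ := h₁
  have hp1 : (1 : ℝ) < p := by exact_mod_cast (Fact.out : p.Prime).one_lt
  have hp0 : (0 : ℝ) < p := lt_trans one_pos hp1
  -- Step 1: the calibrator at `(L, p)` pins `V p d_L = 0`.
  have hV0 : V p (NumberField.discr L) = 0 := by
    obtain ⟨W₁, hE₁, hGM₁, hCS₁, hMF₁, hMFi₁, hNZ₁, hrk₁, hirr₁, hgo₁, hS₁, hH₁, hLt₁, Dt₁, Hd₁, w₁, PL₁, hPL₁,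
      hc₁, s₁, k₁, hs₁, hk₁, W₁', hE₁', D₁, hDf₁, hmin₁, K₁, hK₁, γ₁, I₁, hγ₁, hp₁, N₁, hN₁, f₁, hf₁, ι₁, q₁, Λ₁,
      c₁, e₁, a₁, A₁, e₁', z₁, x₁, y₁, perRatio₁, hq₁, hzeta₁, hy₁, hA₁, hcg₁, hd₁, hdd₁, hR₁, hper0₁, hper₁,
      ι₁', κ₁, γ₁', ΩK₁, Ωp₁, Λf₁, hκ₁, hγ₁', hΩK₁, hBDP₁, X₁, hXv₁, σ₁, hσ₁, hσ0₁, hnorm₁⟩ :=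
      h₂ p h5 L hLq hHp hd4 hodd
    have h := hV W₁ p ⟨hrk₁, hirr₁, Or.inr hgo₁⟩ h5 hS₁ L hLq hH₁ hHp hd4 hodd hLt₁ Dt₁ Hd₁ w₁ PL₁ hPL₁ hc₁
      s₁ k₁ hs₁ hk₁ W₁' D₁ hDf₁ hmin₁ K₁ hK₁ γ₁ I₁ hγ₁ hp₁ N₁ f₁ hf₁ ι₁ q₁ Λ₁ c₁ e₁ a₁ A₁ e₁' z₁ x₁ y₁
      perRatio₁ hq₁ hzeta₁ hy₁ hA₁ hcg₁ hd₁ hdd₁ hR₁ hper0₁ hper₁ ι₁' κ₁ γ₁' ΩK₁ Ωp₁ Λf₁ hκ₁ hγ₁' hΩK₁ hBDP₁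
      X₁ hXv₁ σ₁ hσ₁ hσ0₁
    rw [hnorm₁] at h
    have he := zpow_right_injective₀ hp0 hp1.ne' h
    omega
  -- Step 2: the EXCEPTIONAL conjunct at the target (`ClassX11b ∧ split ⊂ ExceptionalRankOneAt`), with `V p d_L = 0`.
  have h := hVx W p (exceptionalRankOneAt_of_classX11b W p hX hsp) h5 hS L hLq hH hHp hd4 hodd hLt Dt Hd w₀
    PL hPL hc s k hs hk W' D hDf hmin K hK γ I hγ hp N f hf ι q Λ c d₁ a A d' z x y perRatio hq hzeta hy hA hcg
    hd hdd' hR hper0 hper ι' κ γ' ΩK Ωp Λf hκ hγ' hΩK hBDP X hXv σ hσ hσ0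
  rw [hV0, sub_zero, bdvExplicitExponentExcR] at h
  exact h

/-- `S1⁺ ∧ (∀ admissible (L,p), S2R) ⟹ A♭-fam-excR`, conclusion folded into the named `Prop`. -/
theorem aFlatFamExcR_of_bdvChainExcR_of_calibrationR (h₁ : BdvChainExplicitExcR)
    (h₂ : ∀ (p : ℕ) [Fact p.Prime], 5 ≤ p → ∀ (L : Type) [Field L] [NumberField L],
      IsImaginaryQuadratic L → SatisfiesHeegnerHypothesis p L → NumberField.discr L < -4 →
      Odd (NumberField.discr L) → EisensteinPeriodRatioValuationR L p) :
    AFlatFamExcStatementR := by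
  unfold AFlatFamExcStatementR
  exact katoBdpCrossingExcFamilyR_of_bdvChainExcR_of_calibrationR h₁ h₂

/-- ONE CALIBRATION, BOTH SIGNS: `S1⁺ ∧ (∀ admissible (L,p), S2R) ⟹ A♭-famR` too (project S1⁺ to S1R and use the LEAD's
`aFlatFamR_of_bdvChainR_of_calibrationR`, p807901). -/
theorem aFlatFamR_of_bdvChainExcR_of_calibrationR (h₁ : BdvChainExplicitExcR)
    (h₂ : ∀ (p : ℕ) [Fact p.Prime], 5 ≤ p → ∀ (L : Type) [Field L] [NumberField L],
      IsImaginaryQuadratic L → SatisfiesHeegnerHypothesis p L → NumberField.discr L < -4 →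
      Odd (NumberField.discr L) → EisensteinPeriodRatioValuationR L p) :
    AFlatFamStatementR :=
  aFlatFamR_of_bdvChainR_of_calibrationR (bdvChainExplicitNonsplitR_of_excR h₁) h₂

/-- The three-piece corollary at the exceptional sign: S1⁺ ∧ (supply S2a at every admissible `(L,p)`) ∧ S2c ∧ S2bR ⟹ A♭-fam-excR
(S2R recomposed by the LEAD's `eisensteinPeriodRatioValuationR_of_supply_of_portR`). -/
theorem aFlatFamExcR_of_bdvChainExcR_of_supply_of_portR (h₁ : BdvChainExplicitExcR)
    (hsup : ∀ (p : ℕ) [Fact p.Prime], 5 ≤ p → ∀ (L : Type) [Field L] [NumberField L],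
      IsImaginaryQuadratic L → SatisfiesHeegnerHypothesis p L → NumberField.discr L < -4 →
      Odd (NumberField.discr L) → CalibratorSupply L p)
    (hreal : CalibratorDataRealisable) (hport : BstwIntegralPerrinRiouGoodOrdinaryR) : AFlatFamExcStatementR :=
  aFlatFamExcR_of_bdvChainExcR_of_calibrationR h₁ (fun p _ h5 L _ _ hLq hHp hd4 hodd =>
    eisensteinPeriodRatioValuationR_of_supply_of_portR p h5 L hLq hHp hd4 hodd (hsup p h5 L hLq hHp hd4 hodd)
      hreal hport)

/-- Anti-costume certificate, one direction: S1⁺ is IMPLIED by `A♭-famR ∧ A♭-fam-excR ∧ S2bR` (take `V = 0`; the non-exceptional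
conjunct by the LEAD's `bdvChainExplicitNonsplitR_of_aFlatFamR_of_portR`, the exceptional one IS A♭-fam-excR on `ClassX11b ∧ split`
— and `ExceptionalRankOneAt ∧ 5 ≤ p` gives `ClassX11b` with `p ≠ 2`).  S1⁺ alone fixes no value of `V`: it implies neither. -/
theorem bdvChainExplicitExcR_of_aFlatFamR_of_aFlatFamExcR_of_portR (hA : AFlatFamStatementR)
    (hAx : AFlatFamExcStatementR) (hport : BstwIntegralPerrinRiouGoodOrdinaryR) : BdvChainExplicitExcR := by
  -- the LEAD's `bdvChainExplicitNonsplitR_of_aFlatFamR_of_portR` witnesses `V = 0` only inside its proof; re-derive the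
  -- `0`-shift witness for BOTH conjuncts (first bullet = that proof verbatim)
  refine ⟨fun _ _ => 0, ?_, ?_⟩
  · intro W _ _ p _ _ _ _ _ hcls h5 hS L _ _ hLq hH hHp hd4 hodd hLt Dt Hd w₀ PL hPL hc s k hs hk W' _ D hDf hmin
      K hK γ I hγ hp N _ f hf ι q Λ c d₁ a A d' z x y perRatio hq hzeta hy hA0 hcg hd hdd' hR hper0 hper
      ι' κ γ' ΩK Ωp Λf hκ hγ' hΩK hBDP X hXv σ hσ hσ0
    simp only [sub_zero]
    rcases hcls with ⟨hrk, hirr, hmult | hgo⟩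
    · have hX : ClassX11b W p := ⟨hrk, by omega, hmult.1, hirr⟩
      rw [bdvExplicitExponentR_of_not_split W p hmult.1 hmult.2 h5]
      exact hA W p hX h5 hS hmult.2 L hLq hH hHp hd4 hodd hLt Dt Hd w₀ PL hPL hc s k hs hk W' D hDf hmin K hK γ I hγ
        hp N f hf ι q Λ c d₁ a A d' z x y perRatio hq hzeta hy hA0 hcg hd hdd' hR hper0 hper ι' κ γ' ΩK Ωp Λf hκ hγ'
        hΩK hBDP X hXv σ hσ hσ0
    · exact hport W p hrk hirr hgo h5 hS L hLq hH hHp hd4 hodd hLt Dt Hd w₀ PL hPL hc s k hs hk W' D hDf hmin K hK γ I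
        hγ hp N f hf ι q Λ c d₁ a A d' z x y perRatio hq hzeta hy hA0 hcg hd hdd' hR hper0 hper ι' κ γ' ΩK Ωp Λf hκ
        hγ' hΩK hBDP X hXv σ hσ hσ0
  · intro W _ _ p _ _ _ _ _ hcls h5 hS L _ _ hLq hH hHp hd4 hodd hLt Dt Hd w₀ PL hPL hc s k hs hk W' _ D hDf hmin
      K hK γ I hγ hp N _ f hf ι q Λ c d₁ a A d' z x y perRatio hq hzeta hy hA0 hcg hd hdd' hR hper0 hper
      ι' κ γ' ΩK Ωp Λf hκ hγ' hΩK hBDP X hXv σ hσ hσ0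
    obtain ⟨hrk, hirr, hmult, hsp⟩ := hcls
    have hX : ClassX11b W p := ⟨hrk, by omega, hmult, hirr⟩
    simp only [sub_zero]
    rw [bdvExplicitExponentExcR]
    exact hAx W p hX h5 hS hsp L hLq hH hHp hd4 hodd hLt Dt Hd w₀ PL hPL hc s k hs hk W' D hDf hmin K hK γ I hγ
      hp N f hf ι q Λ c d₁ a A d' z x y perRatio hq hzeta hy hA0 hcg hd hdd' hR hper0 hper ι' κ γ' ΩK Ωp Λf hκ hγ'
      hΩK hBDP X hXv σ hσ hσ0

/-! ## §1b The NF road (newform calibrator, d2R P2 — the road the 33169 registry r3 takes): S1⁺-NF, its glue to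
A♭-fam-excR AND A♭-famR, the `∃ P`-bundled registrable PIECES text, and its projection onto r3's `BdvCalibrationPiecesNFR` -/

/-- **S1⁺-NF — `BdvChainExplicitExcNFR P`: ONE shift `V` for the R curve conjunct (§4, non-exceptional curves), the
EXCEPTIONAL curve conjunct (§5) AND the newform conjunct over the port `P` (the calibrators `g_ψ`)** = the LEAD's
`BdvChainExplicitNFR P` (p809731) with the exceptional conjunct added under the same `∃ V`.  Projects onto `BdvChainExplicitNFR P`
and onto S1⁺.  Why it might fail: S1-NF's C1 (the f-dependence of BDV's explicit scalar across Hida families, critic V361) and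
the exceptional residues R1⁺, c′_χ, c1⁺ under the BOOKING CLAIM of rev 1.1 (module docstring; V386 P1(c)): the member-dependent §5
constants are asserted to have the booked total valuation. [cite: BertoliniDarmonVenerucci2022, §4 (38), Lemma 4.6, §5 Thm. 5.1–5.2, pp. 44–48]
[cite: BurungaleSkinnerTianWan2024, Prop. (ERLIint) and §6.2.1, p. 60] -/
@[conjecture]
def BdvChainExplicitExcNFR (P : NFPort) : Prop :=
  ∃ V : ℕ → ℤ → ℤ, BdvChainCurveConjunctR V ∧ BdvChainCurveConjunctExcR V ∧ BdvChainNFConjunct P V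

/-- S1⁺-NF projects onto the LEAD's S1-NF-on-R (forget the exceptional conjunct). -/
theorem bdvChainExplicitNFR_of_excNFR (P : NFPort) (h : BdvChainExplicitExcNFR P) : BdvChainExplicitNFR P := by
  obtain ⟨V, hV, -, hnf⟩ := h
  exact ⟨V, hV, hnf⟩

/-- S1⁺-NF projects onto S1⁺ (forget the newform conjunct). -/
theorem bdvChainExplicitExcR_of_excNFR (P : NFPort) (h : BdvChainExplicitExcNFR P) : BdvChainExplicitExcR := by
  obtain ⟨V, hV, hVx, -⟩ := h
  exact ⟨V, hV, hVx⟩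

/-- **The proved recomposition at the EXCEPTIONAL sign over the NEWFORM calibrator (S2-NF).**  Conclusion = `AFlatFamExcStatementR`.
Proof = the LEAD's `aFlatFamR_of_bdvChainNFR_of_calibrationNF` (p810158) with Step 2 run on the exceptional curve conjunct: S2-NF at
`(L, p)` yields a datum with `X′ ≠ 0` and exact identity; the newform conjunct at that datum yields it shifted by `p^{−V p d_L}`, so
`V p d_L = 0`; the exceptional conjunct at the target (`exceptionalRankOneAt_of_classX11b`) then IS A♭-fam-excR (`rw [bdvExplicitExponentExcR]`).
[cite: BertoliniDarmonVenerucci2022, §5.3 (p. 48) and Lemma 4.6 (p. 44–45)] [cite: BurungaleSkinnerTianWan2024, Thm. 6.4 and §6.2.1, p. 59–60] -/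
theorem aFlatFamExcR_of_bdvChainExcNFR_of_calibrationNF (P : NFPort) (h₁ : BdvChainExplicitExcNFR P)
    (h₂ : ∀ (p : ℕ) [Fact p.Prime], 5 ≤ p → ∀ (L : Type) [Field L] [NumberField L],
      IsImaginaryQuadratic L → SatisfiesHeegnerHypothesis p L → NumberField.discr L < -4 →
      Odd (NumberField.discr L) → EisensteinPeriodRatioValuationNF P L p) :
    AFlatFamExcStatementR := by
  intro W _ _ p _ _ _ _ _ hX h5 hS hsp L _ _ hLq hH hHp hd4 hodd hLt Dt Hd w₀ PL hPL hc s k hs hk W' _ D hDf hmin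
    K hK γ I hγ hp N _ f hf ι q Λ c d₁ a A d' z x y perRatio hq hzeta hy hA hcg hd hdd' hR hper0 hper
    ι' κ γ' ΩK Ωp Λf hκ hγ' hΩK hBDP X hXv σ hσ hσ0
  obtain ⟨V, -, hVx, hVnf⟩ := h₁
  have hp1 : (1 : ℝ) < p := by exact_mod_cast (Fact.out : p.Prime).one_lt
  have hp0 : (0 : ℝ) < p := lt_trans one_pos hp1
  -- Step 1: the newform calibrator at `(L, p)` pins `V p d_L = 0` (verbatim from the LEAD's proof).
  have hV0 : V p (NumberField.discr L) = 0 := by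
    obtain ⟨D₁, hX0, hD⟩ := h₂ p h5 L hLq hHp hd4 hodd
    have h := hVnf p h5 L hLq hHp hd4 hodd D₁
    have hr : D₁.rhs ≠ 0 := by
      rw [← hD]
      exact norm_ne_zero_iff.mpr hX0
    rw [hD] at h
    have h1 : (p : ℝ) ^ (-(V p (NumberField.discr L))) = (p : ℝ) ^ (0 : ℤ) := by
      rw [zpow_zero]
      have h' : (p : ℝ) ^ (-(V p (NumberField.discr L))) * D₁.rhs = 1 * D₁.rhs := by
        rw [one_mul]; exact h.symm
      exact mul_right_cancel₀ hr h'
    have he := zpow_right_injective₀ hp0 hp1.ne' h1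
    omega
  -- Step 2: the EXCEPTIONAL curve conjunct at the target, with `V p d_L = 0`.
  have h := hVx W p (exceptionalRankOneAt_of_classX11b W p hX hsp) h5 hS L hLq hH hHp hd4 hodd hLt Dt Hd w₀
    PL hPL hc s k hs hk W' D hDf hmin K hK γ I hγ hp N f hf ι q Λ c d₁ a A d' z x y perRatio hq hzeta hy hA hcg
    hd hdd' hR hper0 hper ι' κ γ' ΩK Ωp Λf hκ hγ' hΩK hBDP X hXv σ hσ hσ0
  rw [hV0, sub_zero, bdvExplicitExponentExcR] at h
  exact h

/-- ONE NEWFORM CALIBRATION, BOTH SIGNS: S1⁺-NF ∧ S2-NF ⟹ A♭-famR too (project to S1-NF-on-R; the LEAD's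
`aFlatFamR_of_bdvChainNFR_of_calibrationNF`, p810158). -/
theorem aFlatFamR_of_bdvChainExcNFR_of_calibrationNF (P : NFPort) (h₁ : BdvChainExplicitExcNFR P)
    (h₂ : ∀ (p : ℕ) [Fact p.Prime], 5 ≤ p → ∀ (L : Type) [Field L] [NumberField L],
      IsImaginaryQuadratic L → SatisfiesHeegnerHypothesis p L → NumberField.discr L < -4 →
      Odd (NumberField.discr L) → EisensteinPeriodRatioValuationNF P L p) :
    AFlatFamStatementR :=
  aFlatFamR_of_bdvChainNFR_of_calibrationNF P (bdvChainExplicitNFR_of_excNFR P h₁) h₂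

/-- The NF PIECES corollary at the exceptional sign: S1⁺-NF ∧ SUPPLY ∧ REALISABILITY ∧ BSTW ⟹ A♭-fam-excR (S2-NF recomposed by the
LEAD's `eisensteinPeriodRatioValuationNF_of_supply_of_port`). -/
theorem aFlatFamExcR_of_bdvChainExcNFR_of_supply_of_port (P : NFPort) (h₁ : BdvChainExplicitExcNFR P)
    (hsup : ∀ (p : ℕ) [Fact p.Prime], 5 ≤ p → ∀ (L : Type) [Field L] [NumberField L],
      IsImaginaryQuadratic L → SatisfiesHeegnerHypothesis p L → NumberField.discr L < -4 →
      Odd (NumberField.discr L) → CalibratorSupplyNF L p)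
    (hreal : CalibratorDataRealisableNF P) (hbstw : BstwIntegralPerrinRiouNF P) : AFlatFamExcStatementR :=
  aFlatFamExcR_of_bdvChainExcNFR_of_calibrationNF P h₁ (eisensteinPeriodRatioValuationNF_of_supply_of_port P hsup hreal hbstw)

/-- **`BdvCalibrationPiecesExcNFR` — the registrable four-piece text for BOTH signs** = the LEAD's `BdvCalibrationPiecesNFR`
(p809731; the 33169 registry r3's `stub_calibratorSupplyNF ∧ stub_portPiecesNFR`) with `BdvChainExplicitNFR P` STRENGTHENED to
`BdvChainExplicitExcNFR P` under the same `∃ P`: the `P`-free SUPPLY (theorem-shaped in print) and SOME port `P` carrying S1⁺-NF,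
REALISABILITY and BSTW's exact identity.  Projects onto `BdvCalibrationPiecesNFR` (`bdvCalibrationPiecesNFR_of_exc`); gives
A♭-fam-excR AND A♭-famR; behind S0′ it gives BOTH atoms (§2, `katoValuationIneq_bothSigns_of_piecesExcNFR`).  An r3-shaped recipe
for item 33168 would read `⟨stub_calibratorSupplyNF, stub_portPiecesExcNFR⟩` with `stub_portPiecesExcNFR : ∃ P, BdvChainExplicitExcNFR P ∧
CalibratorDataRealisableNF P ∧ BstwIntegralPerrinRiouNF P` (⟹ r3's `stub_portPiecesNFR`): ONE research stub for 404 pairs — recorded,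
NOT registered (W-79; director (558): 33168 carries no skeleton). [cite: BurungaleSkinnerTianWan2024, Prop. 4.23 p. 45, Lemma 8.2 p. 66, Thm. 6.4 p. 59]
[cite: BertoliniDarmonVenerucci2022, §4 (38), §5 Thm. 5.1–5.2, pp. 44–48] [cite: Kato2004Asterisque, Thm. 12.5, p. 229] -/
@[conjecture]
def BdvCalibrationPiecesExcNFR : Prop :=
  (∀ (p : ℕ) [Fact p.Prime], 5 ≤ p → ∀ (L : Type) [Field L] [NumberField L],
      IsImaginaryQuadratic L → SatisfiesHeegnerHypothesis p L → NumberField.discr L < -4 →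
      Odd (NumberField.discr L) → CalibratorSupplyNF L p) ∧
    ∃ P : NFPort, BdvChainExplicitExcNFR P ∧ CalibratorDataRealisableNF P ∧ BstwIntegralPerrinRiouNF P

/-- The exceptional four-piece text projects onto the LEAD's (r3's) four-piece text. -/
theorem bdvCalibrationPiecesNFR_of_exc (h : BdvCalibrationPiecesExcNFR) : BdvCalibrationPiecesNFR := by
  obtain ⟨hsup, P, h₁, hreal, hbstw⟩ := h
  exact ⟨hsup, P, bdvChainExplicitNFR_of_excNFR P h₁, hreal, hbstw⟩

/-- Glue for the exceptional four-piece text (proved): ⟹ A♭-fam-excR. -/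
theorem aFlatFamExcR_of_bdvCalibrationPiecesExcNFR (h : BdvCalibrationPiecesExcNFR) : AFlatFamExcStatementR := by
  obtain ⟨hsup, P, h₁, hreal, hbstw⟩ := h
  exact aFlatFamExcR_of_bdvChainExcNFR_of_supply_of_port P h₁ hsup hreal hbstw

/-- Glue for the exceptional four-piece text (proved): ⟹ A♭-famR as well (through the LEAD's `aFlatFamR_of_bdvCalibrationPiecesNFR`). -/
theorem aFlatFamR_of_bdvCalibrationPiecesExcNFR (h : BdvCalibrationPiecesExcNFR) : AFlatFamStatementR :=
  aFlatFamR_of_bdvCalibrationPiecesNFR (bdvCalibrationPiecesNFR_of_exc h)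

/-! ## §2 The SPLIT door on R: A at the family exponent, the cores, the LEAD's `hFamSplit` binder, and the BY-NAME docks
(ports of `ErratumRoadFiveBstwDoorCrossingR` §2 and `ErratumRoadFiveBstwDoorValuationIneqR` §1–§2 with the sign flipped;
S0′ = the SAME 9-conjunction `hS0`) -/

/-- **A at the FAMILY exponent on R, EXCEPTIONAL sign** (= `ErratumRoadFiveBstwDoor.bstwCrossingNonsplitFamilyR`, p808053, with
`¬ split ↦ split` and A♭-famR ↦ A♭-fam-excR; the abstract glue `bstwCrossing_of_normIdentity` is sign-free — `a_p = ±1` enters it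
only through `ord_p(1 − a_p p⁻¹) = −1`): for every value-pinned Kato family with lift `y` and period ratio `λ`, every Kummer logarithm
`σ ≠ 0` of `proj₀ y`, and `P_L` of infinite order: `∃ e`, `r_f ≠ 0` with `v(σ) + v_p(λ/(q·R⁻_𝟙·∏P_ℓ)) + v_p φ(N) + 1 + ord_p c +
ord_p s + ord_p k + (ord_p r_f − ord_p m_f) = 2·ord_p log_ω e(P_L)`.
[cite: BurungaleSkinnerTianWan2024, §6.2.1 (arXiv:2409.01350 pp. 59–60)] [cite: Castella2018, Thm. 3.2 (arXiv:1704.06608 p. 9)]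
[cite: Kato2004Asterisque, Thm. 12.5 (1) (pp. 221–222)] [cite: KingsLoefflerZerbes2017, Thm. 2.7.4] -/
theorem bstwCrossingExcFamilyR (h32 : thm32_exists_isBDPLFunction_valueAtOne)
    (hVC : castella2018Exceptional_bdpValueContinuity_trivialChar)
    (hH14 : hsieh2014_exists_anticyclotomicPAdicLFunction_unrPeriod)
    (hBDP13 : bertoliniDarmonPrasanna2013_centralValue_reciprocity) (hA : AFlatFamExcStatementR) :
    ∀ (W : WeierstrassCurve ℚ) [W.IsElliptic] [W.IsGloballyMinimal] (p : ℕ) [Fact p.Prime]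
      [ContinuousSMul ℤ_[p] (W.tateModule p)] [Module.Free ℤ_[p] (W.tateModule p)]
      [Module.Finite ℤ_[p] (W.tateModule p)] [NeZero (W.conductorNorm ℤ)],
      ClassX11b W p → 5 ≤ p → Surj W p → W.HasSplitMultiplicativeReductionAtPrime p →
      ∀ (L : Type) [Field L] [NumberField L], IsImaginaryQuadratic L →
        SatisfiesHeegnerHypothesis (W.conductorNorm ℤ) L → SatisfiesHeegnerHypothesis p L →
        NumberField.discr L < -4 → Odd (NumberField.discr L) →
        (W.quadraticTwist (NumberField.discr L : ℚ)).entireLFunction 1 ≠ 0 →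
      ∀ (Dt : ModularParametrizationData W (W.conductorNorm ℤ))
        (Hd : HeegnerDatum (W.conductorNorm ℤ) (NumberField.discr L)) (w₀ : NumberField.InfinitePlace L)
        (PL : (W.baseChange L).toAffine.Point),
        WeierstrassCurve.Affine.Point.map w₀.embedding.toRatAlgHom PL = heegnerPointComplex Dt Hd →
        ¬ (p : ℤ) ∣ Dt.c → ¬ IsOfFinAddOrder PL →
      ∀ (s : ℚ) (k : ℤ),
        (Real.sqrt ((NumberField.discr L).natAbs : ℝ) : ℂ) *
            (W.quadraticTwist (NumberField.discr L : ℚ)).entireLFunction 1 = (s : ℂ) * (minusPeriod Dt.f : ℂ) →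
        (Dt.c : ℝ) * minusPeriod Dt.f = k * W.imaginaryPeriodRat →
      ∀ (W' : WeierstrassCurve ℚ) [W'.IsElliptic] (D : ModularParametrizationData W' (W.conductorNorm ℤ)),
        D.f = Dt.f →
        (∀ (W'' : WeierstrassCurve ℚ) [W''.IsElliptic] (D'' : ModularParametrizationData W'' (W.conductorNorm ℤ)),
            D''.f = D.f → D.modularDegree ≤ D''.modularDegree) →
      ∀ (K : ZpExtension ℚ p) (hK : K.IsCyclotomic) (γ : absoluteGaloisGroup ℚ)
        (I : IwasawaH1Data W p K γ), K.IsTopGenerator γ →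
      ∀ (hp : p ≠ 2) (N : ℕ) [NeZero N] (f : CuspForm (Gamma0 N) 2), IsNewformOf W f →
      ∀ (ι : (n : ℕ) → (CyclotomicField n ℚ →+* ℂ)) (q : ℚ)
        (Λ : ∀ (m : ℕ) (r : Finset (HeightOneSpectrum (𝓞 ℚ))),
          H1 (tateRep W p) (cycSubgroup p m r) →ₗ[ℤ_[p]] ℚ_[p] ⊗[ℚ] CyclotomicField (cycLevel p m r) ℚ)
        (c d₁ a : ℤ) (A : ℕ) (d' : ℤ)
        (z : ∀ (m : ℕ) (r : (cyclotomicLevelsRat p (badPlaces c d₁ A N)).Ideals),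
          H1 (tateRep W p) ((cyclotomicLevelsRat p (badPlaces c d₁ A N)).level m r.1))
        (x : ∀ (m : ℕ) (r : (cyclotomicLevelsRat p (badPlaces c d₁ A N)).Ideals),
          CyclotomicField (cycLevel p m r.1) ℚ)
        (y : I.H) (perRatio : ℚ),
        q ≠ 0 → ZetaBody W p f ι ((q : ℚ) : ℝ) Λ c d₁ a A z x →
        (∀ n : ℕ, I.proj n y =
          levelToLayer W p hK hp (badPlaces c d₁ A N) n
            (z (n + 1) (cyclotomicLevelsRat p (badPlaces c d₁ A N)).idealOne)) →
        0 < A → Int.gcd c (6 * p * A) = 1 → Int.gcd d₁ (6 * p * N) = 1 → (d₁ : ℤ) * d' ≡ 1 [ZMOD (A : ℤ)] →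
        ratCuspFactor f true c d₁ a A d' ≠ 0 → perRatio ≠ 0 →
        plusPeriod f = ((perRatio : ℚ) : ℝ) * W.realPeriodRat →
      ∀ σ : ℚ_[p], HasLocPKummerLog W p (bottomClass W p K I y) σ → σ ≠ 0 →
      ∃ e : L →+* ℚ_[p], congruenceNumber Dt.f ≠ 0 ∧
        σ.valuation + padicValRat p (perRatio /
              (q * ratCuspFactor f true c d₁ a A d' * ∏ ℓ ∈ A.primeFactors.erase p, eulerFactorAtOne W N ℓ)) +
            (padicValNat p (Nat.totient N) : ℤ) +
            1 + padicValInt p Dt.c + padicValRat p s + padicValInt p k +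
            ((padicValNat p (congruenceNumber Dt.f) : ℤ) - padicValNat p D.modularDegree) =
          2 * (padicLogOmega W p e PL).valuation := by
  intro W _ _ p _ _ _ _ _ hX h5 hS hsp L _ _ hLq hH hHp hd4 hodd hLt Dt Hd w₀ PL hPL hc hinf s k hs hk W' _ D hDf hmin
    K hK γ I hγ hp N _ f hf ι q Λ c d₁ a A d' z x y perRatio hq hzeta hy hA0 hcg hd hdd' hR hper0 hper σ hσ hσ0
  exact bstwCrossing_of_normIdentity h32 hVC hH14 hBDP13 hX h5 hS hLq hH hHp hd4 hodd Dt Hd w₀ PL hPL hc hinf s k D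
    (σ.valuation + padicValRat p (perRatio /
      (q * ratCuspFactor f true c d₁ a A d' * ∏ ℓ ∈ A.primeFactors.erase p, eulerFactorAtOne W N ℓ)) +
      (padicValNat p (Nat.totient N) : ℤ))
    (fun ι' κ γ' ΩK Ωp Λf hκ hγ' hΩK hBDP X hXv => by
      have hflatR := hA W p hX h5 hS hsp L hLq hH hHp hd4 hodd hLt Dt Hd w₀ PL hPL hc s k hs hk
        W' D hDf hmin K hK γ I hγ hp N f hf ι q Λ c d₁ a A d' z x y perRatio hq hzeta hy hA0 hcg hd hdd' hR hper0 hper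
        ι' κ γ' ΩK Ωp Λf hκ hγ' hΩK hBDP X hXv σ hσ hσ0
      rw [hflatR]
      congr 1
      ring)

section Cores

variable (hS0 : nonempty_modularParametrizationData ∧ HoffsteinLuo1997_exists_twist_L_one_ne_zero ∧
      (∀ (N : ℕ) [NeZero N] (W : WeierstrassCurve ℚ) (L : Type) [Field L] [NumberField L], gross_zagier N W L) ∧
      modularDegree_dvd_congruenceNumber ∧ mazur_not_dvd_maninConstant_of_odd ∧
      thm32_exists_isBDPLFunction_valueAtOne ∧ castella2018Exceptional_bdpValueContinuity_trivialChar ∧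
      hsieh2014_exists_anticyclotomicPAdicLFunction_unrPeriod ∧ bertoliniDarmonPrasanna2013_centralValue_reciprocity)
include hS0

/-- **Family core ON R, EXCEPTIONAL sign**: for a value-pinned Kato family with Λ-adic lift `y` and a GIVEN Kummer logarithm `σ ≠ 0`
of `proj₀ y` — B's rational `qSha = #Ш_an` and `v(σ) + v_p(λ/(q·R⁻_𝟙·∏P_ℓ)) + v_p φ(N) − 2 ord_p log_ω x̂ ≤ ord_p #Ш_an + ord_p Tam −
2 ord_p #tors − 1`, from S0′ ∧ A♭-fam-excR: the LEAD's sign-free core `valuationIneq_core_of_crossing` (p808156) fed with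
`bstwCrossingExcFamilyR` at `v′ = v(σ) + v_p(λ/…) + v_p φ(N)` (= `valuationIneqNonsplitFamilyR_core` with the sign flipped).
[cite: Kato2004Asterisque, Thm. 12.5 (1) (pp. 221–222), Ex. 13.3 (p. 225)] [cite: GrossZagier1986, Thm. I.(7.3)] -/
theorem valuationIneqExcFamilyR_core (hA : AFlatFamExcStatementR) :
    ∀ (W : WeierstrassCurve ℚ) [W.IsElliptic] [W.IsGloballyMinimal] (p : ℕ) [Fact p.Prime]
      [ContinuousSMul ℤ_[p] (W.tateModule p)] [Module.Free ℤ_[p] (W.tateModule p)] [Module.Finite ℤ_[p] (W.tateModule p)],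
      ClassX11b W p → 5 ≤ p → Surj W p → W.HasSplitMultiplicativeReductionAtPrime p →
      ∀ (h1 : W.mordellWeilRank = 1) (P : Fin W.mordellWeilRank → W.toAffine.Point),
        W.IsMordellWeilBasis P →
      ∀ (K : ZpExtension ℚ p) (hK : K.IsCyclotomic) (γ : absoluteGaloisGroup ℚ)
        (I : IwasawaH1Data W p K γ), K.IsTopGenerator γ →
      ∀ (hp : p ≠ 2) (N : ℕ) [NeZero N] (f : CuspForm (Gamma0 N) 2), IsNewformOf W f →
      ∀ (ι : (n : ℕ) → (CyclotomicField n ℚ →+* ℂ)) (q : ℚ)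
        (Λ : ∀ (m : ℕ) (r : Finset (HeightOneSpectrum (𝓞 ℚ))),
          H1 (tateRep W p) (cycSubgroup p m r) →ₗ[ℤ_[p]] ℚ_[p] ⊗[ℚ] CyclotomicField (cycLevel p m r) ℚ)
        (c d₁ a : ℤ) (A : ℕ) (d' : ℤ)
        (z : ∀ (m : ℕ) (r : (cyclotomicLevelsRat p (badPlaces c d₁ A N)).Ideals),
          H1 (tateRep W p) ((cyclotomicLevelsRat p (badPlaces c d₁ A N)).level m r.1))
        (x : ∀ (m : ℕ) (r : (cyclotomicLevelsRat p (badPlaces c d₁ A N)).Ideals),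
          CyclotomicField (cycLevel p m r.1) ℚ)
        (y : I.H) (perRatio : ℚ),
        q ≠ 0 → ZetaBody W p f ι ((q : ℚ) : ℝ) Λ c d₁ a A z x →
        (∀ n : ℕ, I.proj n y =
          levelToLayer W p hK hp (badPlaces c d₁ A N) n
            (z (n + 1) (cyclotomicLevelsRat p (badPlaces c d₁ A N)).idealOne)) →
        0 < A → Int.gcd c (6 * p * A) = 1 → Int.gcd d₁ (6 * p * N) = 1 → (d₁ : ℤ) * d' ≡ 1 [ZMOD (A : ℤ)] →
        ratCuspFactor f true c d₁ a A d' ≠ 0 → perRatio ≠ 0 →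
        plusPeriod f = ((perRatio : ℚ) : ℝ) * W.realPeriodRat →
      ∀ σ : ℚ_[p], HasLocPKummerLog W p (layerZeroToTop W p K (I.proj 0 y)) σ → σ ≠ 0 →
      ∃ qSha : ℚ, shaAn W = (qSha : ℂ) ∧
        σ.valuation +
              padicValRat p (perRatio /
                (q * ratCuspFactor f true c d₁ a A d' * ∏ ℓ ∈ A.primeFactors.erase p, eulerFactorAtOne W N ℓ)) +
              (padicValNat p (Nat.totient N) : ℤ) -
            2 * (padicLogLocal W p (WeierstrassCurve.Affine.Point.map (Algebra.ofId ℚ ℚ_[p]) (P (Fin.cast h1.symm 0)))).valuation ≤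
          padicValRat p qSha + padicValNat p W.tamagawaProduct - 2 * padicValNat p W.torsionOrder - 1 := by
  intro W _ _ p _ _ _ _ hX h5 hS hsp h1 P hP K hK γ I hγ hp N _ f hf ι q Λ c d₁ a A d' z x y perRatio
    hq hzeta hy hA0 hcg hd hdd' hR hper0 hper σ hσ hσ0
  obtain ⟨-, -, -, -, -, h32, hVC, hH14, hBDP13⟩ := id hS0
  haveI hN : NeZero (W.conductorNorm ℤ) := ⟨(W.conductorNorm_pos_holds).ne'⟩
  exact valuationIneq_core_of_crossing hS0 hX h5 h1 P hP
    (σ.valuation + padicValRat p (perRatio /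
      (q * ratCuspFactor f true c d₁ a A d' * ∏ ℓ ∈ A.primeFactors.erase p, eulerFactorAtOne W N ℓ)) +
      (padicValNat p (Nat.totient N) : ℤ))
    (fun L _ _ hLq hH hHp hd4 hodd hLt Dt Hd w₀ PL hPL hc hinf sB k hsB hk W' _ D hDf hmin =>
      bstwCrossingExcFamilyR h32 hVC hH14 hBDP13 hA W p hX h5 hS hsp L hLq hH hHp hd4 hodd hLt Dt Hd w₀ PL hPL hc hinf
        sB k hsB hk W' D hDf hmin K hK γ I hγ hp N f hf ι q Λ c d₁ a A d' z x y perRatio hq hzeta hy hA0 hcg hd hdd' hR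
        hper0 hper σ hσ hσ0)

/-- **C-sign at the SPLIT sign (kernel form): the LEAD's FAMILY-LEVEL binder `hFamSplit` of
`ErratumRoadFiveKatoFframeValueAtomsOfFamily.valuationIneqSplit_of_family` (p769350) VERBATIM — ν-FREE — from S0′ ∧ A♭-fam-excR.**
The R family core carries `+ v_p φ(N)` on the left; `v_p φ(N) ≥ 0` is dropped (`linarith`), exactly as at the non-split sign
(`ErratumRoadFiveBstwDoor.famValuationIneqNonsplit_of_aFlatFamR`, p808156).
[cite: Kato2004Asterisque, Thm. 12.5 (1) (pp. 221–222), Lemma 13.10 (1) (p. 230)] [cite: KingsLoefflerZerbes2017, Thm. 2.7.4] -/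
theorem famValuationIneqSplit_of_aFlatFamExcR (hA : AFlatFamExcStatementR) :
    ∀ (W : WeierstrassCurve ℚ) [W.IsElliptic] [W.IsGloballyMinimal] (p : ℕ) [Fact p.Prime]
      [ContinuousSMul ℤ_[p] (W.tateModule p)] [Module.Free ℤ_[p] (W.tateModule p)] [Module.Finite ℤ_[p] (W.tateModule p)],
      ClassX11b W p → 5 ≤ p → Surj W p → W.HasSplitMultiplicativeReductionAtPrime p →
      ∀ (h1 : W.mordellWeilRank = 1) (P : Fin W.mordellWeilRank → W.toAffine.Point),
        W.IsMordellWeilBasis P →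
      ∀ (K : ZpExtension ℚ p) (hK : K.IsCyclotomic) (γ : absoluteGaloisGroup ℚ)
        (I : IwasawaH1Data W p K γ), K.IsTopGenerator γ →
      ∀ (hp : p ≠ 2) (N : ℕ) [NeZero N] (f : CuspForm (Gamma0 N) 2), IsNewformOf W f →
      ∀ (ι : (n : ℕ) → (CyclotomicField n ℚ →+* ℂ)) (q : ℚ)
        (Λ : ∀ (k : ℕ) (r : Finset (HeightOneSpectrum (𝓞 ℚ))),
          H1 (tateRep W p) (cycSubgroup p k r) →ₗ[ℤ_[p]] ℚ_[p] ⊗[ℚ] CyclotomicField (cycLevel p k r) ℚ)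
        (c d₁ a : ℤ) (A : ℕ) (d' : ℤ)
        (z : ∀ (k : ℕ) (r : (cyclotomicLevelsRat p (badPlaces c d₁ A N)).Ideals),
          H1 (tateRep W p) ((cyclotomicLevelsRat p (badPlaces c d₁ A N)).level k r.1))
        (x : ∀ (k : ℕ) (r : (cyclotomicLevelsRat p (badPlaces c d₁ A N)).Ideals),
          CyclotomicField (cycLevel p k r.1) ℚ)
        (y : I.H) (perRatio : ℚ),
        q ≠ 0 → ZetaBody W p f ι ((q : ℚ) : ℝ) Λ c d₁ a A z x →
        (∀ n : ℕ, I.proj n y =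
          levelToLayer W p hK hp (badPlaces c d₁ A N) n
            (z (n + 1) (cyclotomicLevelsRat p (badPlaces c d₁ A N)).idealOne)) →
        0 < A → Int.gcd c (6 * p * A) = 1 → Int.gcd d₁ (6 * p * N) = 1 → (d₁ : ℤ) * d' ≡ 1 [ZMOD (A : ℤ)] →
        ratCuspFactor f true c d₁ a A d' ≠ 0 → perRatio ≠ 0 →
        plusPeriod f = ((perRatio : ℚ) : ℝ) * W.realPeriodRat →
      ∀ s : ℚ_[p], HasLocPKummerLog W p (layerZeroToTop W p K (I.proj 0 y)) s → s ≠ 0 →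
      ∀ qSha : ℚ, shaAn W = (qSha : ℂ) →
        s.valuation +
              padicValRat p (perRatio /
                (q * ratCuspFactor f true c d₁ a A d' * ∏ ℓ ∈ A.primeFactors.erase p, eulerFactorAtOne W N ℓ)) -
            2 * (padicLogLocal W p (WeierstrassCurve.Affine.Point.map (Algebra.ofId ℚ ℚ_[p]) (P (Fin.cast h1.symm 0)))).valuation ≤
          padicValRat p qSha + padicValNat p W.tamagawaProduct - 2 * padicValNat p W.torsionOrder - 1 := by
  intro W _ _ p _ _ _ _ hX h5 hS hsp h1 P hP K hK γ I hγ hp N _ f hf ι q Λ c d₁ a A d' z x y perRatio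
    hq hzeta hy hA0 hcg hd hdd' hR hper0 hper s hs hs0 qSha hqSha
  obtain ⟨q₀, hq₀, hineq⟩ := valuationIneqExcFamilyR_core hS0 hA W p hX h5 hS hsp h1 P hP K hK γ I hγ hp N f hf
    ι q Λ c d₁ a A d' z x y perRatio hq hzeta hy hA0 hcg hd hdd' hR hper0 hper s hs hs0
  obtain rfl : qSha = q₀ := Rat.cast_injective (hqSha.symm.trans hq₀)
  have hν : (0 : ℤ) ≤ (padicValNat p (Nat.totient N) : ℤ) := by positivity
  linarith

/-! ### Docking at route ER5's aside item 33168 BY NAME -/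

/-- **`KatoValuationIneqSplitAtFive` (stmt 33168, 370 pairs) from S0′ ∧ A♭-fam-excR, BY NAME** — through the LEAD's dock
`ErratumRoadFiveKatoFframeValueAtomsOfFamily.valuationIneqSplit_of_family` (the item's body is the r5.6 split atom text;
definitional unfolding).  CONDITIONAL: S0′ (nine printed facts) and the OPEN `AFlatFamExcStatementR` are hypotheses. -/
theorem katoValuationIneqSplitAtFive_of_aFlatFamExcR (hA : AFlatFamExcStatementR) :
    Summit.BirchSwinnertonDyer.BirchSwinnertonDyer.Theses.ErratumRoadFive.KatoValuationIneqSplitAtFive :=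
  ErratumRoadFiveKatoFframeValueAtomsOfFamily.valuationIneqSplit_of_family (famValuationIneqSplit_of_aFlatFamExcR hS0 hA)

/-- **ENTRY, MERGED road, split sign** — the atom BY NAME from S0′, S1⁺ `BdvChainExplicitExcR` and the S2R family
`∀ p ≥ 5 ∀ admissible L, EisensteinPeriodRatioValuationR L p`. -/
theorem katoValuationIneqSplitAtFive_of_stubsExcR (h₁ : BdvChainExplicitExcR)
    (h₂ : ∀ (p : ℕ) [Fact p.Prime], 5 ≤ p → ∀ (L : Type) [Field L] [NumberField L],
      IsImaginaryQuadratic L → SatisfiesHeegnerHypothesis p L → NumberField.discr L < -4 →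
      Odd (NumberField.discr L) → EisensteinPeriodRatioValuationR L p) :
    Summit.BirchSwinnertonDyer.BirchSwinnertonDyer.Theses.ErratumRoadFive.KatoValuationIneqSplitAtFive :=
  katoValuationIneqSplitAtFive_of_aFlatFamExcR hS0 (aFlatFamExcR_of_bdvChainExcR_of_calibrationR h₁ h₂)

/-- **ENTRY, PIECES road, split sign** — the atom BY NAME from S0′, S1⁺, the supply S2a at every admissible `(L, p)`, S2c and S2bR. -/
theorem katoValuationIneqSplitAtFive_of_piecesExcR (h₁ : BdvChainExplicitExcR)
    (hsup : ∀ (p : ℕ) [Fact p.Prime], 5 ≤ p → ∀ (L : Type) [Field L] [NumberField L],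
      IsImaginaryQuadratic L → SatisfiesHeegnerHypothesis p L → NumberField.discr L < -4 →
      Odd (NumberField.discr L) → CalibratorSupply L p)
    (hreal : CalibratorDataRealisable) (hport : BstwIntegralPerrinRiouGoodOrdinaryR) :
    Summit.BirchSwinnertonDyer.BirchSwinnertonDyer.Theses.ErratumRoadFive.KatoValuationIneqSplitAtFive :=
  katoValuationIneqSplitAtFive_of_aFlatFamExcR hS0 (aFlatFamExcR_of_bdvChainExcR_of_supply_of_portR h₁ hsup hreal hport)

/-- **BOTH research atoms of the line of record (`stub_valuationIneqSplit` = 33168, 370 pairs; `stub_valuationIneqNonsplit` = 33169,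
34 pairs) BY NAME from S0′ ∧ S1⁺ ∧ the S2R family** — 404 pairs behind ONE research statement and ONE calibrator family (the
non-split half through the LEAD's `katoValuationIneqNonsplitAtFive_of_aFlatFamR`, p808156).  CONDITIONAL; closes nothing by itself. -/
theorem katoValuationIneq_bothSigns_of_stubsExcR (h₁ : BdvChainExplicitExcR)
    (h₂ : ∀ (p : ℕ) [Fact p.Prime], 5 ≤ p → ∀ (L : Type) [Field L] [NumberField L],
      IsImaginaryQuadratic L → SatisfiesHeegnerHypothesis p L → NumberField.discr L < -4 →
      Odd (NumberField.discr L) → EisensteinPeriodRatioValuationR L p) :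
    Summit.BirchSwinnertonDyer.BirchSwinnertonDyer.Theses.ErratumRoadFive.KatoValuationIneqSplitAtFive ∧
      Summit.BirchSwinnertonDyer.BirchSwinnertonDyer.Theses.ErratumRoadFive.KatoValuationIneqNonsplitAtFive :=
  ⟨katoValuationIneqSplitAtFive_of_stubsExcR hS0 h₁ h₂,
    katoValuationIneqNonsplitAtFive_of_aFlatFamR hS0 (aFlatFamR_of_bdvChainExcR_of_calibrationR h₁ h₂)⟩

/-- The same, PIECES road. -/
theorem katoValuationIneq_bothSigns_of_piecesExcR (h₁ : BdvChainExplicitExcR)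
    (hsup : ∀ (p : ℕ) [Fact p.Prime], 5 ≤ p → ∀ (L : Type) [Field L] [NumberField L],
      IsImaginaryQuadratic L → SatisfiesHeegnerHypothesis p L → NumberField.discr L < -4 →
      Odd (NumberField.discr L) → CalibratorSupply L p)
    (hreal : CalibratorDataRealisable) (hport : BstwIntegralPerrinRiouGoodOrdinaryR) :
    Summit.BirchSwinnertonDyer.BirchSwinnertonDyer.Theses.ErratumRoadFive.KatoValuationIneqSplitAtFive ∧
      Summit.BirchSwinnertonDyer.BirchSwinnertonDyer.Theses.ErratumRoadFive.KatoValuationIneqNonsplitAtFive :=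
  katoValuationIneq_bothSigns_of_stubsExcR hS0 h₁ (fun p _ h5 L _ _ hLq hHp hd4 hodd =>
    eisensteinPeriodRatioValuationR_of_supply_of_portR p h5 L hLq hHp hd4 hodd (hsup p h5 L hLq hHp hd4 hodd) hreal hport)

/-- **ENTRY, NF PIECES road, split sign (the r3 shape)** — the atom BY NAME from S0′ and the exceptional four-piece text
`BdvCalibrationPiecesExcNFR` (SUPPLY ∧ ∃P{S1⁺-NF ∧ REALISABILITY ∧ BSTW}). -/
theorem katoValuationIneqSplitAtFive_of_piecesExcNFR (h : BdvCalibrationPiecesExcNFR) :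
    Summit.BirchSwinnertonDyer.BirchSwinnertonDyer.Theses.ErratumRoadFive.KatoValuationIneqSplitAtFive :=
  katoValuationIneqSplitAtFive_of_aFlatFamExcR hS0 (aFlatFamExcR_of_bdvCalibrationPiecesExcNFR h)

/-- **BOTH research atoms BY NAME from S0′ ∧ `BdvCalibrationPiecesExcNFR`** (the non-split half through the projection onto r3's
`BdvCalibrationPiecesNFR`, the LEAD's `aFlatFamR_of_bdvCalibrationPiecesNFR` and `katoValuationIneqNonsplitAtFive_of_aFlatFamR`):
404 pairs behind the print-fed SUPPLY, ONE `∃ P`-bundled research stub and S0′.  CONDITIONAL; closes nothing by itself. -/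
theorem katoValuationIneq_bothSigns_of_piecesExcNFR (h : BdvCalibrationPiecesExcNFR) :
    Summit.BirchSwinnertonDyer.BirchSwinnertonDyer.Theses.ErratumRoadFive.KatoValuationIneqSplitAtFive ∧
      Summit.BirchSwinnertonDyer.BirchSwinnertonDyer.Theses.ErratumRoadFive.KatoValuationIneqNonsplitAtFive :=
  ⟨katoValuationIneqSplitAtFive_of_piecesExcNFR hS0 h,
    katoValuationIneqNonsplitAtFive_of_aFlatFamR hS0 (aFlatFamR_of_bdvCalibrationPiecesNFR (bdvCalibrationPiecesNFR_of_exc h))⟩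

end Cores

end Summit.BirchSwinnertonDyer.BirchSwinnertonDyer.Cruxes.EulerHalfNotRamNoInertSetAtFive.BdvCalibrationExc

end
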